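import Summits.AtomisticToContinuum.Crystallization.Theses.PalmUnimodularRigidity
import Summits.AtomisticToContinuum.Crystallization.Theorems.LayeredLawsSelectHcp.Negative.IntendedModel
import Summits.AtomisticToContinuum.Crystallization.Theorems.LayeredLawsSelectHcp.Negative.FccModel
import Summits.AtomisticToContinuum.Crystallization.Theorems.LayeredLawsSelectHcp.Negative.RootedRedundant
import Summits.AtomisticToContinuum.Crystallization.Theorems.ExcessDecayLiouvilleCoarseGrainsHcpEnergySeries
import Summits.AtomisticToContinuum.Crystallization.Theorems.PalmUnimodularRigidityCruxesToPalmRigidity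
import Summits.AtomisticToContinuum.Crystallization.Theorems.PalmUnimodularRigidityLayeredLawsSelectHcpDefs
import Summits.AtomisticToContinuum.Crystallization.Theorems.PalmUnimodularRigidityLayeredLawsSelectHcpCertificateDefs
import Summits.AtomisticToContinuum.Crystallization.Theorems.PalmUnimodularRigidityLayeredLawsSelectHcpCertificateDefsB
import Summits.AtomisticToContinuum.Crystallization.Theorems.PalmUnimodularRigidityLayeredLawsSelectHcpCorrMeanZero
import Summits.AtomisticToContinuum.Crystallization.Theorems.PalmUnimodularRigidityLayeredLawsSelectHcpCorrMeanZeroBall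
import Summits.AtomisticToContinuum.Crystallization.Theorems.PalmUnimodularRigidityLayeredLawsSelectHcpZeroStress
import Summits.AtomisticToContinuum.Crystallization.Theorems.PalmUnimodularRigidityLayeredLawsSelectHcpLocalCongruence
import Summits.AtomisticToContinuum.Crystallization.Theorems.PalmUnimodularRigidityLayeredLawsSelectHcpRelaxedReference
import Summits.AtomisticToContinuum.Crystallization.Theorems.PalmUnimodularRigidityLayeredLawsSelectHcpSelectionNullCubic
import Summits.AtomisticToContinuum.Crystallization.Theorems.PalmUnimodularRigidityMinimiserShellsEquilibriumInLawGainEvent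
import Summits.AtomisticToContinuum.Crystallization.Theorems.OneCentreSteepnessLadderDominationEnergyLimitHcp
import Summits.AtomisticToContinuum.Crystallization.Theorems.PalmUnimodularRigidityLayeredLawsSelectHcpGlobalInverse
import Summits.AtomisticToContinuum.Crystallization.Theorems.PalmUnimodularRigidityLayeredLawsSelectHcpThresholdInterpolation
import Summits.AtomisticToContinuum.Crystallization.Theorems.PalmUnimodularRigidityLayeredLawsSelectHcpGoodCentre
import Summits.AtomisticToContinuum.Crystallization.Theorems.PalmUnimodularRigidityLayeredLawsSelectHcpChartCubeFrames
import Summits.AtomisticToContinuum.Crystallization.Theorems.PalmUnimodularRigidityLayeredLawsSelectHcpChartInterpolation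
import Literature.Probability.Process.PointStationaryLaw

/-!
# Line `mtp-prestress-split-ergodic-frame` — checked skeleton for crux `LayeredLawsSelectHcp`
(item stmt-AtomisticToContinuum-9226, route `PalmUnimodularRigidity`, rank 3)

LEAD'S RESHAPE (prover-line-stmt-AtomisticToContinuum-9226-c4-0, cycle 5): c3's missing far-field ingredient G5 (bulk co-Lipschitz
ranges, `LeadC3FarField.md` §12–§14) is made an explicit INPUT of the certificate (`stub_certificateOfBulk`, the pairwise constant-free
floor `9/16 · dist (Pᵢ u) (Pᵢ w) ≤ dist (X u) (X w)`) and SUPPLIED by strategist s3's generic global inverse theorem `stub_globalInverse`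
(verbatim from `Lines/covering_colipschitz.lean`) plus the lead's THRESHOLD (Kuhn–Freudenthal) interpolation `stub_chartInterpolation`
(`F = G ∘ Ψ⁻¹`, `G x = ∫₀¹ X(β⁻¹⌈x − t⌉) dt` — no triangulation), itself assembled from three small registered stubs
`stub_thresholdInterpolation` (generic interval-integral estimate), `stub_goodCentre` (Kuhn stars have a Lebesgue number), and
`stub_chartCubeFrames` (one-star frames pin graph balls of radius `2`, from the landed `tube_ballPositions`).  `stub_finiteCertificate`
(c3's statement) is now sorry-free glue (`bulkFloor_of_stubs`).  ALL FIVE G5 STUBS LANDED this cycle (S2 p172603, T1 p172713,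
T2 p172612, T3 p172552, T4 p173627 + vocabulary p173106/p173251; the floor itself as `tube_bulkCoLipschitz`, Theorems/…BulkCoLipschitz.lean):
the ONLY `sorry`s of this file are the two XL cores `stub_selectionFloor` and `stub_certificateOfBulk` (PROMOTE stands; lead memo
`Cruxes/LayeredLawsSelectHcp/LeadC4G5.md`).

LEAD'S RESHAPE (prover-line-stmt-AtomisticToContinuum-9226-c3-0, cycle 4): `stub_finiteCertificate`'s corrector data are BALL-admissible of
radius 8 (`CorrDatum.BallAdmissible`, `Theorems/…CertificateDefsD.lean` p144706) and the glue `hcpTubeRigidity_of_certificate` uses the landed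
`tube_correctorMeanZero_ball` (p148026; chain CertificateDefsE/MeasurableIterIntBall/IterIntCountBall/HatBallLabels/LocalChartIffBall).  Landed
this cycle besides (all `--supports`): the minimiser ENCLOSURE (`tube_minimiserEnclosure` p143804 + kernels B/C/D + assembly), far-range control
G1 `tube_starGreedyStep` p144071 / G2 `tube_farRange` p144636, the chart star frame G3a `tube_chartStarFrame` p144478, the cable lower model
`tube_cableLowerModel` p148311, the path variance identity `tube_pathVariance` p146505, and the SELECTION core's first lemma
`tube_faultAdjacencyCharging` p147400 (with a measurable version of the cubic-site event).  Far-field analysis: `Cruxes/…/LeadC3FarField.md`.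

LEAD'S RESHAPE (prover-line-stmt-AtomisticToContinuum-9226-c2-0, cycle 3): the RIGIDITY core `stub_hcpTubeRigidity` is now PROVED
(sorry-free glue `hcpTubeRigidity_of_certificate`) from two new registered stubs over the landed certificate vocabulary
(`Theorems/…CertificateDefs.lean`, p135300): `stub_correctorMeanZero` (directed orbit-sum correctors have zero mean under point-stationary
hcp-layered laws — the Mecke identity, landed as `tube_weightedTransport`/`tube_meckeIntegral`, plus chart combinatorics) and
`stub_finiteCertificate` (the FINITE real-space certificate: explicit rational first-order scheme + rational PSD second-order data + far-field
transfer + secant/tube closure; architecture and numbers in `Cruxes/LayeredLawsSelectHcp/LeadC2Architecture.md`).  Open `sorry`s of this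
file: `stub_selectionFloor`, `stub_finiteCertificate` (`stub_correctorMeanZero` LANDED, p139851, with eleven helper files).

LEAD'S RESHAPE (prover-line-stmt-AtomisticToContinuum-9226-c1-0, cycle 2): the SELECTION stub
`stub_haggSelection` is no longer a `sorry`: it is PROVED below from the landed potential-free back end
`stub_haggSelection_nullCubicRoot` (Theorems/…SelectionNullCubic.lean, p116671: `P cubicRoot = 0 ⇒ HcpLayered P`,
Palm transfer + Hägg-word combinatorics) and the registered ENERGETIC front end
`stub_haggSelection_cubicRootNull` (fault density zero for minimising layered laws), which is now one of the
two `sorry`s of this file. The skeleton's open stubs are therefore EXACTLY the two analytic cores of the crux: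
`stub_haggSelection_cubicRootNull` (selection energetics: density-form Hägg domination robust in the 1 % tube)
and `stub_tubeZeroDefect` (rigidity: law-level strict local minimality of relaxed hcp in the 1 % tube); every
measure-theoretic, combinatorial, geometric and reference-cell ingredient around them is landed.

LEAD'S RESHAPE (prover-line-stmt-AtomisticToContinuum-9226-0, cycle 1): `stub_palmTransfer` now carries the
LOCAL-FINITENESS hypothesis of the landed Aldous–Lyons lemma `PalmUnimodularRigidity.ae_forall_map_sub_of_ae`
(finite mass on every norm shell `{⌊‖z‖⌋₊ = n}`) instead of "countable carrier" (for a dense countable carrier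
the received-mass functional need not be a.e.-measurable, so the countable form is not provable from the Mecke
identity as typed); the composition supplies local finiteness from the `891/1000` hard core of layered laws
(`rooted_of_pointStationary_layered` + `count_restrict_floorNorm_preimage_lt_top`). With that the stub is
PROVED below (one line), and five registered stubs remain.

Crux (by name; `Negative.DiracLaws.crux_iff` is `Iff.rfl`): for every hard core `δ > 0` and every
probability law `P` on rooted configurations of `ℝ³` that is (H1) a.s. `count|S`, `0 ∈ S`, `S`
`δ`-separated, (H2) point-stationary (Mecke, `−y` convention), (H3) minimising `E_P[h] ≤ e*`, and
(H4) a.s. LAYERED (every point `(1/100)`-good fcc/hcp shell at a scale in `[9/10,1]`, and `S`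
bond-isomorphic to an ideal Barlow stacking), `P`-a.s. the sample is `count|A(hcpStacking a h)`,
`A` a linear isometry, `(a,h) ∈ [1/2,2]²`, with `e(hcp a h) = e*` (`IsRelaxedHcp`).

## The line (idea card `Ideas/mtp-prestress-split-ergodic-frame.md`, crux-ideate r1 k=1; triage r1-1/2/3: pass)

The crux has two halves.  SELECTION (the Hägg word of the chart is a.s. alternating) is the sibling
line `stress-jump-young-hagg-density ∘ stationary-layer-chain` and enters here as ONE registered stub
(`stub_haggSelection`).  This line is the RIGIDITY half: an alternating-word, everywhere-good,
point-stationary MINIMISING law is a.s. an EXACT rotated relaxed hcp crystal, and `e(hcp a₀ h₀) = e*`.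

Mechanism of the rigidity half (card + triage sharpenings), packaged as `stub_tubeCoercivity`:
* PRESTRESS SPLIT WITH WORK TERM (finite shadow `IdeatorOne.PrestressSplitWithWork`, pure algebra,
  PROVED below as `prestressSplitWithWork` — not a stub): with `V_LJ(r) = W(r²)`, `W(s) = s⁻⁶/12 − s⁻³/6`, reference `hcp(a₀,h₀)`,
  squared-length tensions `ω_q = W′(s*_q)` (12 first-shell STRUTS `ω₁ = −0.1206`, all farther labels
  CABLES `ω_q > 0`), `E_P[h] − e(hcp a₀ h₀) = ½E Σ_q [W̃_q(s_q) − W̃_q(s*_q)] + ½Σ_q ω_q E‖b_q − R₀q‖²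
  + Σ_q ω_q⟨R₀q, E[b_q] − R₀q⟩`, `W̃_q = W − ω_q s`, for EVERY global frame `R₀`.
* THE NEW MOVE (card's lever; triage r1-1/2/3 checked it by hand): under H2, with the chart carried as a
  uniform finite mark / conditioned on the invariant σ-field, `q ↦ E[b_q]` is ADDITIVE on the period
  lattice, `E[b_q] = Gq + t·1_B(q)`, so the work term is `S:(R₀ᵀG − I) + ⟨R₀Σ_{A→B}ω_q q, t⟩ = 0` by
  ZERO SITE STRESS `S = Σ_q ω_q q⊗q = 0` of the relaxed reference (`stub_zeroStress`; numerically
  `S = O(1e-4)·I` = cutoff mismatch, kit j012659 A1 / j012726 §A) and zero motif force (C₃ + σ_h).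
* ERGODIC / INVARIANT FJM FRAME + MEASURE-LEVEL KORN: `R₀ := polar(E[Σ b_q qᵀ | 𝓘])`; the
  Friesecke–James–Müller constant is scale-free, ball averages + the ergodic theorem give
  `Σ_struts E‖b_q − R₀q‖² ≤ (1+K)·E[Σ_struts (longitudinal defect)²]` with the Bloch Korn constant
  of the hcp strut framework `1 + K = 8.00` (long-wave basal/C′ shear; NO floppy strut mode on 1882–1928
  k-points; kits j012659 A2, j012726 §B, j012751 B — three independent triage computations).
* HARMONIC + SECANT CERTIFICATE (triage sharpenings r1-1, r1-3 acted on): the closing object is the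
  Bloch-pointwise matrix inequality `Σ_struts[4c₁r²B_q − |ω_q|T_q] + Σ_cables[ω_qT_q − 4τ_q r²B_q] ≽ 0`
  with the cable Laplacians KEPT and the cable concavity tax `τ_q = |W″(s*_q)|/2` carried to `6a`
  (long-wave weight converged 2.56): closing ratio `ρ = 0.40` (reference moduli) … `0.89` (tube-uniform
  moduli), `< 1` in every honest case (kit j013064); equivalently `κ_exact = λ_min(H, S) = 1.824` of the
  bare `2.737` (kit j012659 A2 = ideator-2 j010557); strut wells `W̃_q` globally single-welled with
  secant modulus `c₁ ∈ [0.59, 2.8]` on the tube (`2.2 %` is `|ω₁|/4c₁a*²` at the reference only — the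
  honest small parameter is `ρ`).
* ENDGAME (in the COMPOSITION, sorry-free): `E_P[h] ≤ e* ≤ e(hcp a₀ h₀)` (H3 + `eStar_le`) against
  `E_P[h] ≥ e(hcp a₀ h₀) + κ·E[starDefect]` forces `E[starDefect] = 0`, `starDefect = 0` a.s. at the
  root, hence at every point (`stub_palmTransfer`, Mecke), hence exact congruence
  (`stub_localCongruence`, discrete Liouville), and `e(hcp a₀ h₀) = e*` with no uniqueness of
  `(a₀,h₀)` needed.

Registered stubs (6): `stub_haggSelection` (XL, sibling line's deliverable), `stub_relaxedReference`
(M, near-landed: `ExcessDecayLiouvilleCoarseGrains.windowPin`), `stub_zeroStress` (M, card's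
`HcpZeroStress`), `stub_tubeCoercivity` (XL, card's `TubeCoercivityHcpWord` — THE load-bearing stub of
this line), `stub_palmTransfer` (M, same statement as `MinimiserShells/Lines/coarse-holonomy-liouville`
`stub_everyPoint` up to `Iff.rfl`, = support item 9228's lemma), `stub_localCongruence` (M, pure
geometry).  `isRelaxedHcp_ae_of_stubs : S1 → S2 → S3 → S4 → S5 → S6 → (the crux unfolded by crux_iff)` is
sorry-free and `LayeredLawsSelectHcp_of : LayeredLawsSelectHcp` (the ONLY theorem concluding the crux by
name, no hypotheses) applies the six stubs BY NAME through it.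
Sorry-free extras: `hcpWordRigidity_of_stubs` (the RIGIDITY HALF from stubs 2–6 alone — literally the
statement `HcpWordRigidity` = registered `stub_hcpWordRigidity` of the sibling skeleton
`Lines/stress_jump_young_hagg_density.lean`, whose `LayeredHcp` is this file's `HcpLayered` by `δ`-unfolding;
conversely this file's `stub_haggSelection` is that skeleton's stubs 1–6: the two lines COMPOSE),
`prestressSplitWithWork` (the card's first lemma, proved), `hcpE_eq_energyPerParticle` (bridge to the
landed hcp energy series), `starDefect_nonneg`, `starDefect_eq_zero_of_subset` (non-vacuity direction),
`HcpCharted.countable/.barlowLike`, `hcpCharted_iff` (`Iff.rfl` read-back).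

## Disproof.lean obligations honoured (tree `Cruxes/LayeredLawsSelectHcp/Disproof.lean`, gen 1, "resists";
## landed `Theorems/LayeredLawsSelectHcp/Negative/*`, imported here: DiracLaws, FccModel, RootedRedundant, IntendedModel)
* `layeredLawsSelectHcp_false_without_energy` (H3 load-bearing, witness `fccLaw`): H3 is a hypothesis of
  `stub_haggSelection` (the fcc Palm law is Layered but NOT hcp-charted; it fails H3 by `m_H ≈ 7.25e-5`,
  the contrapositive of `layeredLawsSelectHcp_false_of_fcc_rootEnergy_le`) and H3 is used ONCE MORE in
  the composition (the sandwich).  `stub_tubeCoercivity` has no energy hypothesis but concludes an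
  INEQUALITY valid for every hcp-charted tube law, consistent with `fccLaw` (not in its class) and with
  the intended model (`IntendedModel.hcpPalm_*`: equality case).
* `crux_iff_without_rooted` (H1 redundant): H1 is used only to read `0 ∈ S` in the composition; `δ` is
  never used.
* `not_pointStationaryPlus_hcpPalm` (sign of Mecke): every stub quantifies `Negative.DiracLaws.PointStationary`
  = the crux's `−y` identity verbatim.
* Kill criteria `…_false_of_fcc_rootEnergy_le` / `…_of_periodic_competitor` / `…_of_bravais_minimiser`:
  they bite `stub_haggSelection` only (the selection half lives or dies with `J₂ < 0` + domination,
  items 0737/3063/0670); no stub of the rigidity half compares stackings.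
* No stub is an instance of a landed Negative lemma: none deletes H3 from a congruence conclusion, none
  uses the `+y` Mecke identity, none asserts a Bravais presentation of hcp (`HcpNotBravais`).
* `ledger negatives` (Crystallization): 4146 (D₅ₕ shell, 0.67 % strain) and 3506 are outside the
  hcp-charted class (degree-5 poles excluded by the chart) — untouched.
-/

noncomputable section

namespace Summit.AtomisticToContinuum.Crystallization.Cruxes.LayeredLawsSelectHcp.MtpPrestressSplitErgodicFrame

open MeasureTheory Set
open Literature.MathematicalPhysics.StatisticalMechanics Literature.Geometry.DiscreteGeometry
open Literature.Probability.Process (map_sub_count_restrict count_restrict_singleton_ne_zero_iff)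
open Summit.AtomisticToContinuum.Crystallization.Theses.PalmUnimodularRigidity (LayeredLawsSelectHcp)
open Summit.AtomisticToContinuum.Crystallization.Theorems.ChargedEnergyGapNegative (eStar eStar_le)
open Summit.AtomisticToContinuum.Crystallization.Theorems.LayeredLawsSelectHcp.Negative.DiracLaws
  (Rooted PointStationary meanRootEnergy GoodShell BarlowLike Layered IsRelaxedHcp crux_iff)
open Summit.AtomisticToContinuum.Crystallization.Theorems.LayeredLawsSelectHcp.Negative.FccModel
  (set_eq_of_count_restrict_eq)
open Summit.AtomisticToContinuum.Crystallization.Theorems.LayeredLawsSelectHcp.Negative.RootedRedundant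
  (rooted_of_pointStationary_layered)
open Summit.AtomisticToContinuum.Crystallization.Theorems.ExcessDecayLiouvilleCoarseGrains
  (hcpEnergySeries_of_eq)

/-- Euclidean `3`-space. [folklore] -/
local notation "E3" => EuclideanSpace ℝ (Fin 3)

/-! ## Vocabulary of the line

LEAD'S RESHAPE (cycle 1): the vocabulary `hcpQ`, `hcpE`, `hcpSite`, `ljSqDeriv`, `hcpSiteStress`, `hcpStarIdx`,
`refStar`, `rootStar`, `starDefect`, `HcpCharted`, `HcpLayered` (+ `starDefect_nonneg`, `hcpCharted_iff`,
`card_hcpStarIdx`) now lives VERBATIM in the landed reviewed Defs module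
`Theorems/PalmUnimodularRigidityLayeredLawsSelectHcpDefs.lean` (p86599) and is imported here (aliases below), so
that the registered stubs are proved in `Theorems/` files over the same declarations and the stub signatures are
textually unchanged. -/

open Summit.AtomisticToContinuum.Crystallization.Theorems.PalmUnimodularRigidity.LayeredLawsSelectHcp
  (hcpQ hcpE hcpSite ljSqDeriv hcpSiteStress hcpStarIdx refStar rootStar starDefect HcpCharted HcpLayered
    starDefect_nonneg hcpCharted_iff card_hcpStarIdx cubicRoot stub_haggSelection_nullCubicRoot
    atoms IsRootedChart rootedCharts labelShift reRoot chartAvg CorrDatum corrector IsLocalFunctional nearLabels nearEnergy hNear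
    nearBall IsLocalChart ballLabels)

/-- The series IS the energy per particle of the hcp periodic configuration (landed theorem
`hcpEnergySeries_of_eq`, third clause). [folklore] -/
theorem hcpE_eq_energyPerParticle {a h : ℝ} (ha : a ≠ 0) (hh : h ≠ 0) :
    hcpE a h = (hcpPeriodicConfiguration ha hh).energyPerParticle lennardJones :=
  ((hcpEnergySeries_of_eq a h ha hh hcpQ rfl).2.2).symm

/-- Non-vacuity direction: if the reference star itself lies in the root star (e.g. the intended model,
the Palm law of `hcp(a, h)` seen from an `A`-site), the congruence defect vanishes (`A = id`). [folklore] -/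
theorem starDefect_eq_zero_of_subset {a h : ℝ} {μ : Measure E3}
    (hsub : ∀ v ∈ hcpStarIdx, hcpSite a h v ∈ rootStar μ) : starDefect a h μ = 0 := by
  apply le_antisymm _ (starDefect_nonneg a h μ)
  have hbdd : BddBelow (Set.range fun A : E3 ≃ₗᵢ[ℝ] E3 =>
      ∑ v ∈ hcpStarIdx, (Metric.infDist (A (hcpSite a h v)) (rootStar μ)) ^ 2) := by
    refine ⟨0, ?_⟩
    rintro _ ⟨A, rfl⟩
    exact Finset.sum_nonneg fun _ _ => sq_nonneg _
  refine (ciInf_le hbdd (LinearIsometryEquiv.refl ℝ E3)).trans (le_of_eq ?_)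
  refine Finset.sum_eq_zero fun v hv => ?_
  rw [LinearIsometryEquiv.coe_refl, id_eq, Metric.infDist_zero_of_mem (hsub v hv)]
  simp

/-- The hcp stacking is countable (image of `ℤ³`). [folklore] -/
theorem countable_hcpStacking (a h : ℝ) : (hcpStacking a h).Countable := by
  have hsub : hcpStacking a h ⊆
      Set.range (fun v : ℤ × ℤ × ℤ => barlowPos a h alternatingHagg v.1 v.2.1 v.2.2) := by
    rintro x ⟨k, i, j, rfl⟩
    exact ⟨(k, i, j), rfl⟩
  exact (Set.countable_range _).mono hsub

/-- An hcp-charted set is countable. [folklore] -/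
theorem hcpCharted_countable {S : Set E3} (hS : HcpCharted S) : S.Countable := by
  obtain ⟨Φ, hbij, -⟩ := hS
  rw [← hbij.image_eq]
  exact (countable_hcpStacking _ _).image _

/-- An hcp-charted set is Barlow-like (the crux's H4 global clause), with the alternating word. [folklore] -/
theorem hcpCharted_barlowLike {S : Set E3} (hS : HcpCharted S) : BarlowLike S :=
  ⟨alternatingHagg, isHaggSeq_alternating, hS⟩

/-! ## The card's first lemma, PROVED (finite shadow of the measure-level split; not a stub) -/

/-- Pair energy through SQUARED lengths: `sqEnergy W x = ∑_{i<j} W ‖x j − x i‖²`. [folklore] -/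
def sqEnergy {N : ℕ} (W : ℝ → ℝ) (x : Fin N → E3) : ℝ :=
  ∑ i, ∑ j ∈ Finset.Ioi i, W (‖x j - x i‖ ^ 2)

/-- **Prestress split with explicit work term** (`IdeatorOne.PrestressSplitWithWork`, the card's typed
first lemma, here PROVED): for ANY reference `y`, any bond weights `ω` and any deformed `x`, with
`δ_ij = (x j − x i) − (y j − y i)`,
`E(x) − E(y) = Σ_{i<j} [W̃_ij(s_ij) − W̃_ij(s*_ij)] + Σ_{i<j} ω_ij ‖δ_ij‖² + 2 Σ_{i<j} ω_ij ⟪y j − y i, δ_ij⟫`,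
`W̃_ij(s) = W(s) − ω_ij s` — termwise `‖r + δ‖² = ‖r‖² + 2⟪r, δ⟫ + ‖δ‖²` (no symmetry of `ω` and no
force balance needed).  At the measure level the last (WORK) term has expectation
`2 S:(R₀ᵀG − I) + 2⟨R₀ Σ_{A→B} ω_q q, t⟩` by MTP additivity, killed by `stub_zeroStress`. [folklore] -/
theorem prestressSplitWithWork {N : ℕ} (W : ℝ → ℝ) (ω : Fin N → Fin N → ℝ) (x y : Fin N → E3) :
    sqEnergy W x - sqEnergy W y =
      (∑ i, ∑ j ∈ Finset.Ioi i,
        ((W (‖x j - x i‖ ^ 2) - ω i j * ‖x j - x i‖ ^ 2) -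
          (W (‖y j - y i‖ ^ 2) - ω i j * ‖y j - y i‖ ^ 2))) +
      (∑ i, ∑ j ∈ Finset.Ioi i, ω i j * ‖(x j - x i) - (y j - y i)‖ ^ 2) +
      2 * ∑ i, ∑ j ∈ Finset.Ioi i, ω i j * inner ℝ (y j - y i) ((x j - x i) - (y j - y i)) := by
  have key : ∀ i j : Fin N,
      W (‖x j - x i‖ ^ 2) - W (‖y j - y i‖ ^ 2) =
        ((W (‖x j - x i‖ ^ 2) - ω i j * ‖x j - x i‖ ^ 2) -
            (W (‖y j - y i‖ ^ 2) - ω i j * ‖y j - y i‖ ^ 2)) +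
          ω i j * ‖(x j - x i) - (y j - y i)‖ ^ 2 +
          2 * (ω i j * inner ℝ (y j - y i) ((x j - x i) - (y j - y i))) := by
    intro i j
    have h : ‖x j - x i‖ ^ 2 =
        ‖y j - y i‖ ^ 2 + 2 * inner ℝ (y j - y i) ((x j - x i) - (y j - y i)) +
          ‖(x j - x i) - (y j - y i)‖ ^ 2 := by
      have e : x j - x i = (y j - y i) + ((x j - x i) - (y j - y i)) := by abel
      conv_lhs => rw [e]
      rw [norm_add_sq_real]
    rw [h]
    ring
  simp only [sqEnergy, Finset.mul_sum, ← Finset.sum_add_distrib, ← Finset.sum_sub_distrib]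
  exact Finset.sum_congr rfl fun i _ => Finset.sum_congr rfl fun j _ => key i j

/-! ## The six planner stubs and the two registered analytic cores

### STUB 1 — Hägg selection in density form

**(The SELECTION half; deliverable of the sibling line
`stress-jump-young-hagg-density ∘ stationary-layer-chain`, entered here by statement).**  A minimising
(`E_P[h] ≤ e*`) point-stationary probability law that is a.s. layered (every point `(1/100)`-good,
global Barlow chart with SOME Hägg word) is a.s. hcp-charted: the word is alternating.  Mechanism
(sibling cards + triage): the orientation-free `1/6`-transport to adjacent-layer neighbours makes the
layer chain seen from the root shift-stationary (`½(T+T⁻¹)`-invariance ⇒ `T`-invariance); with fault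
density `ρ = P(root's layer cubic)`, `E_P[h] ≥ e(hcp*) + m_H ρ − (Young losses ≤ 2.7e-4·m_H ρ)`
(`LetterChainUnionBound`/`HaggDominationCurrent` = 0737 with 3063's half-domination, `m_H = 7.25e-5`,
cut-force coupling `Σk|g_k| = 16.7|J₂|`, `c_gap = 18.9`, word-uniform near-field coercivity
`λ_T = λ_short(hcp)`); `E_P[h] ≤ e* ≤ e(hcp*)` forces `ρ = 0`, a union over layers gives a.s. no cubic
layer, and an all-hexagonal word is `±alternatingHagg`.  H3 is used HERE (Disproof:
`layeredLawsSelectHcp_false_without_energy` — the fcc Palm law is layered, point-stationary and NOT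
hcp-charted).  Why it might fail: fcc or a polytype wins for the full `r⁻⁶` tail (margin `1e-4|e*|`,
couplings 0670 uncertified; Disproof kill criterion `…_false_of_periodic_competitor`), or the Young /
coercivity budget fails on the scale strip `a ∈ [0.90, 0.94)` outside 3063's box (card
`sheared-tube-registry-selection` covers it with ratio `≥ 230`). Size XL.

RESHAPED by the lead (cycle 2): SPLIT as `stub_haggSelection_nullCubicRoot ∘ stub_haggSelection_cubicRootNull`.
The potential-free back end (`P cubicRoot = 0 ⇒ HcpLayered P`: Aldous–Lyons Palm transfer makes every atom a
hexagonal site a.s., and an all-hexagonal Barlow-like configuration is hcp-charted — the Hägg word is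
`±alternatingHagg`) is LANDED (`Theorems/…SelectionWord.lean` p115935, `Theorems/…SelectionNullCubic.lean`
p116671); what remains is the ENERGETIC front end, and `stub_haggSelection` itself is proved from the two.
The energetic front end is in turn reduced (same cycle, sorry-free glue `stub_haggSelection_cubicRootNull`)
to its `e*`-FREE analytic core `stub_selectionFloor` below. -/

/-- **STUB 1-core — the SELECTION FLOOR (density-form Hägg domination, robust in the 1 % tube; the
`e*`-free analytic core of the selection half; lead's reshape, cycle 2).**  For the relaxed reference
`(a₀, h₀)` (window + global hcp-minimality as named inputs), NO point-stationary layered probability law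
at or below the relaxed-hcp level charges a fault: `E_P[h] ≤ hcpE a₀ h₀ ⇒ P(cubicRoot) = 0`, where
`cubicRoot` = "the root is a cubic site of its own bond graph" (intrinsic, chart-free; `P(cubicRoot)` =
density of atoms in `c`-layers).  This is the registered energetic front end with the uncomputable
threshold `e*` replaced by the explicit hcp level (`e* ≤ e(hcp a₀ h₀) = hcpE a₀ h₀`), i.e. the sharp
qualitative form of a FAULT PRICE `hcpE a₀ h₀ + m·P(cubicRoot) ≤ E_P[h]`, `m > 0`.  Mechanism (sibling cards
`stress-jump-young-hagg-density`, `stationary-layer-chain`; triage r1-1/2/3): (a) the ideal own-word reference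
of a layered sample pays `≈ ρ_c · 7.27e-5` above relaxed hcp (Hägg domination, items 0737 + 3063: `J₂ =
−7.265e-5 < 0`, `|J₂| / Σ_{k≥3}(k−1)|J_k| = 414`; Disproof §23 certifies fcc `+7.185e-5` and every
period-`≤ 8` polytype `≥ +9.7e-6` above `e_hcp,min` on the whole tube, all scales); (b) the shift-stationarity
of the layer chain seen from the root (MTP with the orientation-free `1/6`-kernel) turns the finite-volume
domination with `O(1)` boundary term into the density statement; (c) relaxation robustness: the ideal faulted
reference is not in equilibrium but its cut forces are `≤ 24|J₂|`, so by coercivity of the word-uniform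
near field (`λ_T = λ_short(hcp) = 1.92`, `c_gap ≥ 12`) the Young bound caps the relaxation gain at
`F²/(2c_gap) ≈ 1e-7 ≪ m` per fault layer (Disproof §23: certified-float supercell relaxations gain `≤ 1.4e-7`,
i.e. `3e-4` of the fault energy); (d) far from the reference scale (`a ∈ [0.89, 0.94)`, outside 3063's box,
where `J₂` may change sign under compression) the gross elastic excess `hcpE(a,·) − hcpE(a₀,h₀) ≫ m` pays
instead.  Consistency: the relaxed-hcp Palm law (`E = hcpE`, `P(cubicRoot) = 0`,
`SelectionNullCubic.hcpPalm_cubicRoot`); the fcc Palm law (`P(cubicRoot) = 1`, `fccLaw_cubicRoot`) has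
`E − hcpE a₀ h₀ ≥ 7.185e-5 > 0` (Disproof §23, certified), so it is not a counterexample; WITHOUT the energy
hypothesis the conclusion is false (`cubicRootNull_false_without_energy`, landed).  Why it might fail: only
with the crux (a faulted tube-law at or below `hcpE(a₀,h₀)` is a layered competitor of hcp, hence — if hcp
attains `e*` — a refutation of the crux itself); the risk is SIZE — (c) is an infinite-dimensional coercivity estimate with certified
Bloch-space positivity, (a) needs interval lattice sums at the `1e-6` level as Lean certificates. Size XL
(crux-sized: promoted by the lead, see the lead's memo `Cruxes/LayeredLawsSelectHcp/NOTES.md` = item evidence `promote-memo.md`). -/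
theorem stub_selectionFloor :
    ∀ a₀ h₀ : ℝ, 189 / 200 ≤ a₀ → a₀ ≤ 199 / 200 → 77 / 100 ≤ h₀ → h₀ ≤ 163 / 200 →
      (∀ a h : ℝ, 0 < a → 0 < h → hcpE a₀ h₀ ≤ hcpE a h) →
      ∀ P : Measure (Measure E3), IsProbabilityMeasure P → PointStationary P → Layered P →
        meanRootEnergy P ≤ hcpE a₀ h₀ → P cubicRoot = 0 := by
  sorry

/-- **The registered energetic front end `stub_haggSelection_cubicRootNull`, sorry-free from the selection
floor** (glue): with the landed relaxed reference `(a₀,h₀)` (`stub_relaxedReference`, p113318),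
`E_P[h] ≤ e* ≤ e(hcp a₀ h₀) = hcpE a₀ h₀` (H3, `eStar_le`, `hcpE_eq_energyPerParticle`) puts a minimising
layered law in the sublevel class of `stub_selectionFloor`. [folklore] -/
theorem stub_haggSelection_cubicRootNull :
    ∀ P : Measure (Measure E3), IsProbabilityMeasure P → PointStationary P →
      meanRootEnergy P ≤ eStar → Layered P → P cubicRoot = 0 := by
  intro P hP hStat hEn hLay
  obtain ⟨a₀, h₀, ha₁, ha₂, hh₁, hh₂, hmin⟩ :=
    Summit.AtomisticToContinuum.Crystallization.Theorems.PalmUnimodularRigidity.LayeredLawsSelectHcp.stub_relaxedReference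
  have ha0 : 0 < a₀ := by linarith
  have hh0 : 0 < h₀ := by linarith
  have hstar : eStar ≤ hcpE a₀ h₀ := by
    rw [hcpE_eq_energyPerParticle ha0.ne' hh0.ne']
    exact eStar_le _
  exact stub_selectionFloor a₀ h₀ ha₁ ha₂ hh₁ hh₂ hmin P hP hStat hLay (hEn.trans hstar)

/-- **STUB 1, assembled (sorry-free glue)**: Hägg selection in density form = the registered energetic front
end `stub_haggSelection_cubicRootNull` (fault density zero: a minimising point-stationary layered law does not
charge the event "the root is a cubic site") followed by the LANDED potential-free back end
`stub_haggSelection_nullCubicRoot`. [folklore] -/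
theorem stub_haggSelection :
    ∀ P : Measure (Measure E3), IsProbabilityMeasure P → PointStationary P →
      meanRootEnergy P ≤ eStar → Layered P → HcpLayered P :=
  fun P hP hStat hEn hLay =>
    stub_haggSelection_nullCubicRoot P hP hStat hLay
      (stub_haggSelection_cubicRootNull P hP hStat hEn hLay)

/-- **STUB 2 — the relaxed hcp reference exists and sits in the window.**  The hcp energy per particle
`hcpE a h` has a GLOBAL minimiser `(a₀, h₀)` on the open quadrant, and it lies in
`[0.945, 0.995] × [0.77, 0.815]` (numerically `(0.97127, 0.79293)`, `c/a = 1.63276`, Hessian eigenvalues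
`{15.7, 34.0}`; kits j012726 §A, j012751 F, j012659 A1).  Proof route: `hcpE → +∞` at the axes (hard
core), `hcpE → e(1-D chain) ≈ −0.086` (`a → ∞`) and `→ e(2-D triangular) ≈ −0.28` (`h → ∞`) against the
trial value `−0.7175`, so a minimising sequence is confined to a compact box (coarse certified bounds);
continuity gives a minimiser; inside 3063's box the LANDED `ExcessDecayLiouvilleCoarseGrains.windowPin`
(`stub_pinFromSeries` + certified `stub_pinNumerics`) pins it to `|a − 0.97| ≤ 1/40`,
`|h/√(2/3) − 0.97| ≤ 1/40`, inside the window stated here (`√(2/3) ∈ [0.8164, 0.8166]`).  Why it might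
fail: only by an arithmetic slip in the coarse bounds (the close-packed basin is `≥ 4 %` below every
other `c/a` regime: bcc-like `−0.687`, simple-hexagonal `≈ −0.61`). Size M. -/
theorem stub_relaxedReference :
    ∃ a₀ h₀ : ℝ, 189 / 200 ≤ a₀ ∧ a₀ ≤ 199 / 200 ∧ 77 / 100 ≤ h₀ ∧ h₀ ≤ 163 / 200 ∧
      ∀ a h : ℝ, 0 < a → 0 < h → hcpE a₀ h₀ ≤ hcpE a h :=
  -- LANDED (wave 1): Theorems/PalmUnimodularRigidityLayeredLawsSelectHcpRelaxedReference.lean (p113318)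
  Summit.AtomisticToContinuum.Crystallization.Theorems.PalmUnimodularRigidity.LayeredLawsSelectHcp.stub_relaxedReference

/-- **STUB 3 — zero stress of relaxed hcp (card's first lemma `HcpZeroStress`, deterministic input of
the work-term cancellation).**  At a global (hence interior, critical) minimiser of `hcpE` on the open
quadrant the full `3 × 3` squared-length site stress vanishes: `∂_a hcpE = 0 ⇔ S₁₁ + S₂₂ = 0` and
`∂_h hcpE = 0 ⇔ S₃₃ = 0` (termwise differentiation of the absolutely convergent series under the
dilations `(x,y,z) ↦ (λx, λy, νz)`, cf. the landed `hcpPinC_hasDerivAt_tsum`), `S₁₁ = S₂₂`, `S₁₂ = 0` by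
the three-fold axis through the root (it maps each coset `L`, `w + L` to itself: `R₁₂₀ w = w − u`), and
`S₁₃ = S₂₃ = 0` by the horizontal mirror `z ↦ −z` (letters of `alternatingHagg` depend on parity only).
Checked true as typed by triage r1-1/r1-3; numerically `S = O(1e-4)·I` = tail-cutoff mismatch
(j012659 A1).  Why it might fail: it cannot for an interior critical point; the only content at risk is
the summability / differentiability bookkeeping. Size M. -/
theorem stub_zeroStress :
    ∀ a₀ h₀ : ℝ, 0 < a₀ → 0 < h₀ → (∀ a h : ℝ, 0 < a → 0 < h → hcpE a₀ h₀ ≤ hcpE a h) →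
      ∀ l m : Fin 3, hcpSiteStress a₀ h₀ l m = 0 :=
  -- LANDED (wave 1): Theorems/PalmUnimodularRigidityLayeredLawsSelectHcpZeroStress.lean (p91498)
  Summit.AtomisticToContinuum.Crystallization.Theorems.PalmUnimodularRigidity.LayeredLawsSelectHcp.stub_zeroStress

/-- **STUB 4 — measure-level tube coercivity about the zero-stress reference (card's
`TubeCoercivityHcpWord`; THE LOAD-BEARING STUB of this line; no minimality hypothesis on the law).**
For the relaxed reference `(a₀, h₀)` (window, global hcp-minimality and ZERO STRESS as named inputs)
there is `κ > 0` such that EVERY point-stationary probability law a.s. carried by hcp-charted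
everywhere-`(1/100)`-good configurations satisfies
`e(hcp a₀ h₀) + κ · E_P[starDefect a₀ h₀] ≤ E_P[h]` (with `starDefect` `P`-integrable: it is bounded by
`12·(2.2)²` on the class and a.e. equal to a Giry-measurable functional of `μ(B)`'s).
Mechanism = the card: (i) prestress split with explicit work term (algebra); (ii) MTP additivity of the
mean labelled bond vectors (chart randomised uniformly over the finite set of rooted charts and carried
as a mark, or conditioned on the invariant σ-field — state it so in every Mecke step, triage r1-2) makes
the expected work term `S:(R₀ᵀG − I) + ⟨R₀Σ_{A→B}ω_q q, t⟩`, which VANISHES by `stub_zeroStress` and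
zero motif force, for every frame; (iii) invariant (ergodic) FJM frame `R₀ = polar(E[Σ b_q qᵀ | 𝓘])` and
the measure-level Korn inequality `Σ_struts E‖b_q − R₀q‖² ≤ (1+K)·E[longitudinal defects²]`,
`1 + K = 8.00` (no floppy Bloch mode of the hcp strut framework); (iv) the Bloch-pointwise certificate
`Σ_struts[4c₁r²B_q − |ω_q|T_q] + Σ_cables[ω_qT_q − 4τ_q r²B_q] ≽ 0` with cable Laplacians KEPT and the
cable concavity tax carried to `6a` (closing ratio `ρ ∈ [0.40, 0.89] < 1`; `κ_exact = λ_min(H,S) =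
1.824`), plus secant single-welledness of the tilted strut wells `W̃_q` on the whole 1 % tube
(`c₁ ≥ 0.59` at the stretched corner `r = 1.01`) and `|W″| ≤ 0.063·(…)` summable cable tax for the
nonlinear remainder; (v) `E[starDefect] ≤ C·E[Σ_{star bars} stretch²]` by infinitesimal rigidity of the
centred anticuboctahedral framework (36 bars, 13 nodes) and one Mecke averaging.  Consistency checks:
equality for the intended model (Palm law of `hcp(a₀,h₀)`, views `±hcp`, `starDefect = 0` via `A = ±id`);
strict for `hcp(a,h)`, `(a,h) ≠ (a₀,h₀)` in the tube (Hessian `{15.7, 34}` vs `κ·12|δ|²`); affine strains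
pay the (positive) relaxed-hcp elastic moduli; `fccLaw` is not in the class.  Honours
`layeredLawsSelectHcp_false_without_energy`: no energy hypothesis, but the conclusion is an inequality,
not a congruence.  Why it might fail: the nonlinear tube is wider than the certified harmonic margin
suggests (stacked worst case `ρ = 1.05` when tube-sup cable tax, `c₁ = 1.0` AND dropped cable Laplacians
coincide — j013064; cure: keep the Laplacians / split the tube, compressed regions pay through
`c₁,secant = 2.2–2.8`), or the Lean cost of the marked-chart Mecke calculus and of the `ℤ³`-ergodic /
invariant-σ-field step (Mathlib has Birkhoff for one transformation only) proves prohibitive (then the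
line parks, it is not refuted). Size XL.

RESHAPED by the lead (cycle 1, `stub_tubeCoercivity` → `stub_tubeRigidity`): the composition consumes the
coercive inequality only through its EQUALITY CASE under H3, so the registered statement is now the minimal
one the line needs — for the relaxed reference `(a₀,h₀)` (window, global hcp-minimality, zero stress) and every
MINIMISING (`E_P[h] ≤ e*`) point-stationary hcp-layered probability law: (i) the ENERGY FLOOR
`hcpE a₀ h₀ ≤ E_P[h]` (relaxed hcp is below every hcp-charted tube law in mean root energy) and (ii) ZERO
CONGRUENCE DEFECT a.s. at the root.  This drops the uniform constant `κ`, the integrability conjunct and the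
measurability of `starDefect` (technical debts with no mathematical content for the crux), lets a prover use
H3-consequences such as the landed `PalmUnimodularRigidityMinimiserShells.EquilibriumInLaw.stub_equilibriumInLaw`
(a.s. Sütő `μ`GSC at `μ = e*`: force balance and finite-modification optimality of almost every sample), and is
implied by the old κ-form (sandwich).  It still implies uniqueness of the hcp energy minimiser among tube cells
(apply it to the Palm law of `hcp(a₁,h₁)`), which is true for Lennard-Jones and part of its content.
SPLIT (same cycle) into an energy floor and a zero-defect stub — and then the ENERGY FLOOR WAS DROPPED from the
composition altogether (lead, cycle 1, following the Disproof's mutation note "a prover gets the energy identity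
from linearity AFTER the a.s. structure"): once `stub_tubeZeroDefect` gives zero defect a.s., Palm transfer and
local congruence give `μ = count|A(hcpStacking a₀ h₀)` a.s., the root energy of every such sample IS
`hcpE a₀ h₀` (`rootEnergy_isometric_hcp`, proved below), so `E_P[h] = hcpE a₀ h₀ ≤ e*` and the sandwich closes
with NO floor inequality.  The floor ("relaxed hcp minimises the mean root energy over all point-stationary
hcp-layered laws") stays TRUE and kit-testable but is no longer an obligation of this line; the only rigidity stub
is 4b. (This declaration is a placeholder keeping the section numbering.) [folklore] -/
theorem floor_not_a_stub_anymore : True := trivial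

/-- **STUB 4b — ZERO CONGRUENCE DEFECT of minimising hcp-layered laws (the strictness half of the rigidity
inequality; lead's split of `stub_tubeRigidity`, cycle 1).**  For the relaxed reference `(a₀,h₀)` (window, global
hcp-minimality, zero stress) and every MINIMISING (`E_P[h] ≤ e*`, hence `≤ hcpE a₀ h₀` by `eStar_le`)
point-stationary hcp-layered probability law, almost surely the root star is an exact linear-isometric copy of
the relaxed reference star (`starDefect a₀ h₀ = 0`).  H3 is kept (not the weaker `E_P[h] ≤ hcpE a₀ h₀`) so that a
prover may use its landed consequence `tube_ae_isMuGSC` (a.s. Sütő `μ`GSC at `e*`: force balance, optimality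
against finite modifications).  Mechanism: the coercive form of the card (prestress split, MTP additivity + zero
stress kill the work term, FJM frame + measure Korn, Bloch certificate) gives `E_P[h] ≥ hcpE a₀ h₀ + κE[starDefect]`,
and the sandwich forces `E[starDefect] = 0`; alternatively `μ`GSC ⇒ equilibrium ⇒ a scale-invariant Liouville theorem
for tube equilibria ⇒ affine ⇒ `μ`GSC pins the cell.  Implies uniqueness of the hcp energy minimiser among tube
cells (true for Lennard-Jones; part of the content). Size XL.

RESHAPED by the lead (cycle 2): reduced by sorry-free glue to its `e*`-FREE analytic core `stub_hcpTubeRigidity`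
(below: the same implication with the uncomputable threshold `e*` replaced by the explicit hcp level
`hcpE a₀ h₀` — the sublevel form of the energy floor over point-stationary hcp-layered laws with its equality
case, which is what every known mechanism actually proves); H3 enters only through `e* ≤ e(hcp a₀ h₀) = hcpE a₀ h₀`. -/
theorem tubeZeroDefect_split_note : True := trivial

/-- **STUB R3 (lead c2 reshape, cycle 3; v2: near-admissible data) — DIRECTED ORBIT-SUM CORRECTORS HAVE ZERO MEAN.**  For every
NEAR-admissible datum `d` (a coefficient, a functional `φ` reading only the near ball `nearBall` through a measurable bounded function,
and a shift label `c ∈ nearBall`), the corrector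
`corrector d μ = coef · ∑ᶠ_{X ∈ rootedCharts μ} (φ (reRoot X c) − φ X)` is `P`-integrable with ZERO MEAN under every point-stationary
hcp-layered probability law.  Mechanism (`Cruxes/LayeredLawsSelectHcp/LeadC2Architecture.md` §1, §4): a.s. the sample is `count|S`,
`S` hcp-charted with `0 ∈ S`, and has exactly twelve rooted charts (R3-B: a rooted chart is determined by its values on the star —
`stub_localCongruenceStarAut` + propagation — and the twelve star automorphisms extend); the Mecke identity in Bochner form
(`tube_meckeIntegral`, landed) with `g(μ, y) = Σ_{X ∈ rootedCharts μ, X c = y} φ(reRoot X c)` and the pointwise bijection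
`(y, Ψ) ↦ Ψ ∘ τ_c` between {charts at atoms `y` sending `τ_c⁻¹ 0` to the old root} and the rooted charts at the root gives
`E[Σ_X φ(reRoot X c)] = E[Σ_X φ X]`; integrability from boundedness of `φ` and `#rootedCharts = 12`; measurability through iterated
Campbell integrals (`exists_isSFiniteKernel_apply_eq_self`).  Why it might fail: only the Lean cost of chart measurability; the statement
is the mass-transport principle. Size L. -/
theorem stub_correctorMeanZero :
    ∀ d : CorrDatum, d.NearAdmissible →
      ∀ P : Measure (Measure (EuclideanSpace ℝ (Fin 3))), IsProbabilityMeasure P → PointStationary P → HcpLayered P →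
        Integrable (corrector d) P ∧ ∫ μ, corrector d μ ∂P = 0 :=
  -- LANDED (lead c2, cycle 3): Theorems/…LayeredLawsSelectHcpCorrMeanZero.lean (p139851)
  Summit.AtomisticToContinuum.Crystallization.Theorems.PalmUnimodularRigidity.LayeredLawsSelectHcp.stub_correctorMeanZero

/-- **STUB R2 (lead c2 reshape, cycle 3; lead c3 reshape, cycle 4: corrector data are now BALL-admissible of radius `8` — shift and
support in the graph ball of radius `8` — instead of near-admissible (radius `2`); the zero-mean input is the landed generalisation
`tube_correctorMeanZero_ball` (p148026), which the honest far field needs anyway: the mid band `2 < |g| ≤ 4` is kept EXACT in the pointwise part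
and its path terms are transported by shifts of graph norm ≤ 4, and the law part transports along label paths = single re-rootings
(`reRoot_reRoot`); see `Cruxes/LayeredLawsSelectHcp/LeadC3FarField.md` §5–§7) — THE FINITE CERTIFICATE WITH ITS FAR-FIELD TRANSFER.**
For the relaxed reference `(a₀,h₀)`
(window, global `hcpE`-minimality, zero stress) there are `κ > 0`, a LOCAL far-field surrogate `φfar` and finitely many admissible
corrector data `ds` such that (LAW PART) for every point-stationary hcp-layered probability law the near energy `hNear` and the
surrogate `chartAvg φfar` are integrable with `E[hNear] + E[chartAvg φfar] ≤ E_P[h]` (far-field transfer: the far bonds' energy is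
bounded below, IN MEAN, by the affine extrapolation of the far tension onto the twelve struts minus curvature/concavity taxes — the law
parallelogram calculus of the memo §2 (P3)–(P4), infinitely many zero-mean correctors summed inside this proof), and (POINTWISE PART) on
EVERY rooted hcp-charted tube configuration `S` the finite inequality
`0 ≤ hNear + chartAvg φfar − hcpE a₀ h₀ − κ·starDefect a₀ h₀ + Σ_i corrector (ds i)` holds for `μ_S = count|S`.  Content of the
pointwise part (memo §2 (P1)–(P7), §6, §7): the EXPLICIT RATIONAL first-order scheme (every near-label orbit's linear form reduces over ℚ to
the two stress invariants, which vanish by ZERO STRESS: `c_in = c_out = 0`), second-order directed correctors = a rational PSD certificate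
for the localized prestressed Hessian of relaxed LJ hcp (numerics: Bloch truth `λ = 0.263` star-defect units; localisation ratio = kit
j020714/j020715), far taxes (affordable at `R_s = 2.05a`), secant single-welledness on the tube (strut loss ≤ 24 %), gross excess far from
the reference scale, and a certified ENCLOSURE of the irrational minimiser (R4) to transfer the rational second-order data.  Why it might
fail: the PSD localisation may need longer corrector ranges than `ds` drawn from star functionals with shifts to graph distance ≤ 2 (then
enlarge the families; the architecture is unchanged), and the nonlinear closure on the stretched corner of the tube is tight.  Size XL
(finite: one rational 456×456 PSD identity + interval lattice sums + L-sized pointwise algebra). -/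
theorem finiteCertificate_reshape_note : True := trivial

/-! ## Lead c4 reshape (cycle 5): the far field's BULK CO-LIPSCHITZ floor (G5) made explicit and supplied

Lead c3 closed the law part of the certificate modulo ONE geometric ingredient without a proof plan (`LeadC3FarField.md`
§12–§14, G5): a constant-free PAIRWISE range floor `θ · dist (Pᵢ u) (Pᵢ w) ≤ dist (X u) (X w)` for rooted labelled charts of
everywhere-good hcp-charted configurations (`Pᵢ = hcpSite 1 √(2/3)`).  Strategist s3's line `covering-colipschitz` supplies it
by a global inverse function theorem (S2 below, verbatim) applied to a continuous interpolation of the chart; this reshape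
adopts S2 and REPLACES s3's tet–oct honeycomb interpolation by the THRESHOLD (Kuhn–Freudenthal) interpolant, which needs no
triangulation bookkeeping: in integer label coordinates `x ∈ ℝ³` (the hcp indices `(k,i,j)` relabelled by
`β (k,i,j) = (k, i+j+[k odd], j)`, in which the ideal hcp is the image of `ℤ³` under a piecewise-affine zigzag shear `Ψ`,
`Ψ x = x₂ g₁ + x₃ g₂ + ζ(x₁) ω + x₁ √(2/3) e₃`, `g₁ = (1,0,0)`, `g₂ = (−1/2, √3/2, 0)`, `ω = (−1/2, √3/6, 0)`, `ζ` the
`2`-periodic tent with `ζ k = [k odd]`), put `G x = ∫₀¹ X(β⁻¹ ⌈x − t·(1,1,1)⌉) dt` and `F = G ∘ Ψ⁻¹`.  Then `F (Pᵢ u) = X u`,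
and on every ball of radius `1/25` the map `F` is within relative Lipschitz defect `2 c₂ √6 < 3/8` of the one-star similarity
`a • A` of a nearby label (`c₂ = 758/10000` from the LANDED `tube_ballPositions`; the labels the interpolant reads on such a ball
form a Kuhn star, which lies in the graph ball of radius `2`; `‖dΨ d‖² = ‖d‖²/2 + (d₁ ∓ d₂ ± d₃)²/2 ≥ ‖d‖²/2` gives the `√6`).
With S2 (`δ = 3/8`, `m = 9/10`) this yields `BulkCoLipschitz (9/16)` pairwise with NO additive constant (c3's G2
`tube_farRange` had slope `9/16` but `−7`).  The certificate stub now TAKES the bulk floor as input (`stub_certificateOfBulk`);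
`stub_finiteCertificate` is sorry-free glue.  The constant `9/16` is below the `≈ 0.765` c3's far-field budget wants — improving it
is a matter of the adjacent-frame constant `K = 5/100` of `tube_adjacentFrames` (true `≈ 1.2/100`), recorded as the follow-up;
the structure does not change. -/

/-- **STUB S2 `stub_globalInverse` (strategist s3, verbatim) — global inverse function theorem for maps uniformly locally
close to similarities.**  If `F : ℝ³ → ℝ³` is, on EVERY ball of a fixed radius `r`, within relative Lipschitz defect `δ < 1` of
a similarity `a • A` (`A` a linear isometry, ratio `a ≥ m > 0`, both allowed to depend on the ball), then `F` is a bijection of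
`ℝ³` and GLOBALLY `(1 − δ) m`-co-Lipschitz.  Proof plan: the hypothesis makes `F` continuous, injective and `(1−δ)a`-co-Lipschitz
on `r`-balls; Banach's fixed point theorem on closed balls (`p ↦ y + (a A)⁻¹(z − F y − (Φ p − Φ y))` is a `δ`-contraction) gives
`ball (F y) ((1−δ) a s) ⊆ F (closedBall y s)` for `s < r`, hence `F` is open; the LANDED covering criterion
`HullExactificationCascadeRobustBarlowTemplate.develop_coveringCriterion` (continuous + open + injective on `r/2`-balls + images of
`r/2`-balls contain concentric `(1−δ) m r/4`-balls ⇒ bijective, via `IsCoveringMap` and simple connectivity of `ℝ³`) gives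
bijectivity; the inverse is locally `1/((1−δ)m)`-Lipschitz, and chaining along the straight segment `[F p, F q]` in steps shorter
than `(1−δ) m r/4` gives the global co-Lipschitz bound.  Hadamard / F. John 1968 / Plastock 1974.  Size M. [folklore] -/
theorem stub_globalInverse :
    ∀ (F : EuclideanSpace ℝ (Fin 3) → EuclideanSpace ℝ (Fin 3)) (r δ m : ℝ), 0 < r → 0 ≤ δ → δ < 1 → 0 < m →
      (∀ y : EuclideanSpace ℝ (Fin 3), ∃ a : ℝ, m ≤ a ∧ ∃ A : EuclideanSpace ℝ (Fin 3) ≃ₗᵢ[ℝ] EuclideanSpace ℝ (Fin 3),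
        ∀ p ∈ Metric.ball y r, ∀ q ∈ Metric.ball y r, ‖(F p - F q) - a • (A p - A q)‖ ≤ δ * a * ‖p - q‖) →
      Function.Bijective F ∧ ∀ p q : EuclideanSpace ℝ (Fin 3), (1 - δ) * m * ‖p - q‖ ≤ ‖F p - F q‖ :=
  -- LANDED (lead c4 wave 1, worker): Theorems/…LayeredLawsSelectHcpGlobalInverse.lean (p172603)
  Summit.AtomisticToContinuum.Crystallization.Theorems.PalmUnimodularRigidity.LayeredLawsSelectHcp.stub_globalInverse

/-- **STUB T1 `stub_thresholdInterpolation` — the threshold (Kuhn–Freudenthal) interpolant: vertex values and the deviation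
estimate.**  For labelled data `Y : ℤ³ → ℝ³` put `G x = ∫₀¹ Y ⌈x − t·(1,1,1)⌉ dt` (`x ∈ ℝ³`, ceilings componentwise).  Then
(i) `G m = Y m` at integer points (for `t ∈ (0,1)`, `⌈m_j − t⌉ = m_j`), and (ii) for every linear `M : ℝ³ → ℝ³`, all `x, y` and
every `D ≥ 0` bounding `‖(Y − M)⌈x − t⌉ − (Y − M)⌈y − t⌉‖` for all `t ∈ (0,1)`:
`‖G x − G y − M (x − y)‖ ≤ D (|x₁ − y₁| + |x₂ − y₂| + |x₃ − y₃|)`.  Proof: `∫₀¹ ⌈x_j − t⌉ dt = x_j` (the ceiling is `⌈x_j⌉` on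
`[0, x_j − ⌈x_j⌉ + 1)` and `⌈x_j⌉ − 1` after), so by linearity `M (x − y) = ∫₀¹ (M⌈x−t⌉ − M⌈y−t⌉) dt` and the difference is
`∫₀¹ [(Y−M)⌈x−t⌉ − (Y−M)⌈y−t⌉] dt`; the integrand vanishes unless `⌈x_j − t⌉ ≠ ⌈y_j − t⌉` for some `j`, a set of `t ∈ [0,1]` of
measure `≤ |x_j − y_j|` (a `1`-periodic union of intervals of that length), and is bounded by `D` there.  Integrability: the
integrands are measurable (`Int.measurable_ceil`) and take finitely many values on `[0,1]` (`⌈x_j − t⌉ ∈ {⌈x_j⌉ − 1, ⌈x_j⌉}`).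
Pure real analysis (interval integrals), no project imports.  Size M. [folklore] -/
theorem stub_thresholdInterpolation :
    ∀ (Y : ℤ × ℤ × ℤ → EuclideanSpace ℝ (Fin 3)),
      (∀ m : ℤ × ℤ × ℤ,
        (∫ t in (0 : ℝ)..1, Y (⌈(m.1 : ℝ) - t⌉, ⌈(m.2.1 : ℝ) - t⌉, ⌈(m.2.2 : ℝ) - t⌉)) = Y m) ∧
      ∀ (M : ℝ × ℝ × ℝ →ₗ[ℝ] EuclideanSpace ℝ (Fin 3)) (x y : ℝ × ℝ × ℝ) (D : ℝ), 0 ≤ D →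
        (∀ t ∈ Set.Ioo (0 : ℝ) 1,
          ‖(Y (⌈x.1 - t⌉, ⌈x.2.1 - t⌉, ⌈x.2.2 - t⌉) -
              M ((⌈x.1 - t⌉ : ℝ), (⌈x.2.1 - t⌉ : ℝ), (⌈x.2.2 - t⌉ : ℝ))) -
            (Y (⌈y.1 - t⌉, ⌈y.2.1 - t⌉, ⌈y.2.2 - t⌉) -
              M ((⌈y.1 - t⌉ : ℝ), (⌈y.2.1 - t⌉ : ℝ), (⌈y.2.2 - t⌉ : ℝ)))‖ ≤ D) →
        ‖(∫ t in (0 : ℝ)..1, Y (⌈x.1 - t⌉, ⌈x.2.1 - t⌉, ⌈x.2.2 - t⌉)) -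
            (∫ t in (0 : ℝ)..1, Y (⌈y.1 - t⌉, ⌈y.2.1 - t⌉, ⌈y.2.2 - t⌉)) - M (x - y)‖ ≤
          D * (|x.1 - y.1| + |x.2.1 - y.2.1| + |x.2.2 - y.2.2|) :=
  -- LANDED (lead c4 wave 1, worker): Theorems/…LayeredLawsSelectHcpThresholdInterpolation.lean (p172713)
  Summit.AtomisticToContinuum.Crystallization.Theorems.PalmUnimodularRigidity.LayeredLawsSelectHcp.stub_thresholdInterpolation

/-- **STUB T2 `stub_goodCentre` — every sup-ball of radius `1/16` in `ℝ³` sits well inside a Kuhn star.**  For every `x₀` there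
are an integer point `m` and a threshold `τ ∈ [0,1]` with `τ − 1 ≤ x_j − m_j ≤ τ` (`j = 1,2,3`) for all `x` with
`‖x − x₀‖ ≤ 1/16` (sup norm of `ℝ × ℝ × ℝ`).  Consequence used by the lead: for such `x` and `t ∈ (0,1)`,
`⌈x − t·(1,1,1)⌉ ∈ m + {0,1}³` if `t < τ` and `∈ m − {0,1}³` if `t ≥ τ`.  Proof: with `τ = i/8`, `i ∈ {0,…,7}`, the
condition on coordinate `j` fails only if `x₀_j` is within `1/16` of `τ + ℤ`; each coordinate excludes at most one of the eight
candidates (two candidates are `1/8` apart), so one survives; then `m_j = ⌊x₀_j − τ⌋ + 1`.  Size S. [folklore] -/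
theorem stub_goodCentre :
    ∀ x₀ : ℝ × ℝ × ℝ, ∃ m : ℤ × ℤ × ℤ, ∃ τ : ℝ, 0 ≤ τ ∧ τ ≤ 1 ∧
      ∀ x : ℝ × ℝ × ℝ, ‖x - x₀‖ ≤ 1 / 16 →
        (τ - 1 ≤ x.1 - m.1 ∧ x.1 - m.1 ≤ τ) ∧ (τ - 1 ≤ x.2.1 - m.2.1 ∧ x.2.1 - m.2.1 ≤ τ) ∧
          (τ - 1 ≤ x.2.2 - m.2.2 ∧ x.2.2 - m.2.2 ≤ τ) :=
  -- LANDED (lead c4 wave 1, worker): Theorems/…LayeredLawsSelectHcpGoodCentre.lean (p172612)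
  Summit.AtomisticToContinuum.Crystallization.Theorems.PalmUnimodularRigidity.LayeredLawsSelectHcp.stub_goodCentre

/-- **STUB T3 `stub_chartCubeFrames` — the one-star frame at ANY label pins the graph ball of radius `2` around it.**  For a
rooted labelled chart `X` of an everywhere-good hcp-charted `S` and every label `c` there is a frame `(a, A)`, `a ∈ [9/10, 1]`,
with `‖X (labelShift c u) − X c − a • A (Pᵢ (labelShift c u) − Pᵢ c)‖ ≤ (758/10000) a` for all `u ∈ ballLabels 2`.  Proof: the
re-rooted chart `reRoot X c` is a rooted chart of the translated configuration (`tube_reRoot_isRootedChart`, `good_image_sub`),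
`exists_frame_reRoot` / `tube_chartStarFrame` give its one-star frame and `tube_ballPositions` (`ball_positions_le`, `n = 2`) the
bound `‖reRoot X c u − a • A (Pᵢ u)‖ ≤ c₂ a`; finally `Pᵢ (labelShift c u) − Pᵢ c = ± Pᵢ u` (`hcpSite_labelShift`), the sign
absorbed into `A` (`−A` is a linear isometry).  Size S. [folklore] -/
theorem stub_chartCubeFrames :
    ∀ S : Set (EuclideanSpace ℝ (Fin 3)), (∀ x ∈ S, GoodShell S x) → HcpCharted S →
      ∀ X : ℤ × ℤ × ℤ → EuclideanSpace ℝ (Fin 3), IsRootedChart S X → ∀ c : ℤ × ℤ × ℤ,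
        ∃ a : ℝ, 9 / 10 ≤ a ∧ a ≤ 1 ∧ ∃ A : EuclideanSpace ℝ (Fin 3) ≃ₗᵢ[ℝ] EuclideanSpace ℝ (Fin 3),
          ∀ u ∈ ballLabels 2,
            ‖X (labelShift c u) - X c -
                a • A (hcpSite 1 (Real.sqrt (2 / 3)) (labelShift c u) - hcpSite 1 (Real.sqrt (2 / 3)) c)‖ ≤
              758 / 10000 * a :=
  -- LANDED (lead c4 wave 1, worker): Theorems/…LayeredLawsSelectHcpChartCubeFrames.lean (p172552)
  Summit.AtomisticToContinuum.Crystallization.Theorems.PalmUnimodularRigidity.LayeredLawsSelectHcp.stub_chartCubeFrames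

/-- **STUB T4 `stub_chartInterpolation` (the lead's; REPLACES s3's honeycomb version — radius `1/25`, defect `3/8`) — a tube chart
extends to a map of `ℝ³` locally `3/8`-close to one-star similarities.**  For a rooted labelled chart `X` of an everywhere-good
hcp-charted `S` there is `F : ℝ³ → ℝ³` with `F (Pᵢ u) = X u` for all labels and, on every ball of radius `1/25`, a similarity
`a • A`, `a ≥ 9/10`, with `‖(F p − F q) − a • (A p − A q)‖ ≤ (3/8) a ‖p − q‖`.  Construction: `F = G ∘ Ψ⁻¹` as in the section
docstring; assembled from T1 (estimate with `M = a A ∘ dΨ` on each closed slab `k ≤ x₁ ≤ k+1`, cutting the segment `[p,q]` at the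
one slab boundary it may cross), T2 (the labels read on `Ψ⁻¹(ball)`, sup-radius `≤ √2/25 < 1/16`, form a Kuhn star
`m ± {0,1}³`), T3 (at `c = β⁻¹ m`: the `14` Kuhn-star labels are `labelShift c u`, `u` among
`(0,±1,0), (0,0,±1), (0,1,−1), (0,−1,1), (1,−1,0), (1,0,0), (−1,−1,0), (−1,0,−1)` (star) and `(1,−2,1), (1,−1,1), (−1,−2,0), (−1,−1,−1)`
(radius `2`), so pairs are `2 c₂ a`-close) and the slab Gram identity `‖dΨ d‖² ≥ ‖d‖²/2` (`2 c₂ √6 = 0.3714 ≤ 3/8`).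
Why it might fail: only an arithmetic slip in the `28`-case label table (kit `kit/kuhnstar.py` checks it).  Size M/L. [folklore] -/
theorem stub_chartInterpolation :
    ∀ S : Set (EuclideanSpace ℝ (Fin 3)), (∀ x ∈ S, GoodShell S x) → HcpCharted S →
      ∀ X : ℤ × ℤ × ℤ → EuclideanSpace ℝ (Fin 3), IsRootedChart S X →
        ∃ F : EuclideanSpace ℝ (Fin 3) → EuclideanSpace ℝ (Fin 3),
          (∀ u : ℤ × ℤ × ℤ, F (hcpSite 1 (Real.sqrt (2 / 3)) u) = X u) ∧
          ∀ y : EuclideanSpace ℝ (Fin 3), ∃ a : ℝ, 9 / 10 ≤ a ∧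
            ∃ A : EuclideanSpace ℝ (Fin 3) ≃ₗᵢ[ℝ] EuclideanSpace ℝ (Fin 3),
              ∀ p ∈ Metric.ball y (1 / 25 : ℝ), ∀ q ∈ Metric.ball y (1 / 25 : ℝ),
                ‖(F p - F q) - a • (A p - A q)‖ ≤ 3 / 8 * a * ‖p - q‖ :=
  -- LANDED (lead c4): Theorems/…LayeredLawsSelectHcpChartInterpolation.lean (p173627; parts …KuhnChartDefs p173106, …KuhnChartCut p173251)
  Summit.AtomisticToContinuum.Crystallization.Theorems.PalmUnimodularRigidity.LayeredLawsSelectHcp.stub_chartInterpolation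

/-- **STUB R2′ `stub_certificateOfBulk` (lead c4 reshape of `stub_finiteCertificate`) — THE FINITE CERTIFICATE WITH ITS FAR-FIELD
TRANSFER, GIVEN THE BULK CO-LIPSCHITZ FLOOR.**  Same conclusion as c3's `stub_finiteCertificate` (law part: far-field transfer in
mean for ONE local surrogate `φfar`, corrector data ball-admissible of radius `8`; pointwise part: the finite inequality
`0 ≤ hNear + chartAvg φfar − hcpE a₀ h₀ − κ·starDefect + Σ corrector`), now under the explicit geometric input every design of the
law part uses (`LeadC3FarField.md` §12: range floors for the far squared lengths): the pairwise constant-free floor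
`9/16 · dist (Pᵢ u) (Pᵢ w) ≤ dist (X u) (X w)` for every rooted chart of every everywhere-good hcp-charted configuration (supplied
by S2 + T4, `bulkFloor_of_stubs`).  Proof plan = c2/c3's architecture (`LeadC2Architecture.md`, `LeadC3FarField.md` §5–§15): explicit
rational first-order scheme (regenerated, kit j026879), PSD second-order certificate (tax-free LMI feasible at κ = 0.26; taxed LMI
at −9e-3 with the 2-class corrector family, enrichment pending), path Cauchy–Schwarz concavity taxes, ε-family tail (`tube_farTail`),
enclosure (`tube_minimiserEnclosure`).  Why it might fail: c3's tax table wants `θ ≈ 0.765` in the bands `8 < N < 40` while this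
input has `θ = 9/16` — the prover of this stub either sharpens T3/T4's constant (adjacent-frame constant `K`: `5/100 → ≈ 2/100`
suffices) or spends LMI margin; the statement with `9/16` is the weakest input, hence the strongest (still believed true:
the conclusion is believed true outright).  Size XL (PROMOTE stands, lead memos c1–c3). [folklore] -/
theorem stub_certificateOfBulk :
    (∀ S : Set (EuclideanSpace ℝ (Fin 3)), (∀ x ∈ S, GoodShell S x) → HcpCharted S →
      ∀ X : ℤ × ℤ × ℤ → EuclideanSpace ℝ (Fin 3), IsRootedChart S X → ∀ u w : ℤ × ℤ × ℤ,
        9 / 16 * dist (hcpSite 1 (Real.sqrt (2 / 3)) u) (hcpSite 1 (Real.sqrt (2 / 3)) w) ≤ dist (X u) (X w)) →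
    ∀ a₀ h₀ : ℝ, 189 / 200 ≤ a₀ → a₀ ≤ 199 / 200 → 77 / 100 ≤ h₀ → h₀ ≤ 163 / 200 →
      (∀ a h : ℝ, 0 < a → 0 < h → hcpE a₀ h₀ ≤ hcpE a h) →
      (∀ l m : Fin 3, hcpSiteStress a₀ h₀ l m = 0) →
      ∃ κ : ℝ, 0 < κ ∧ ∃ φfar : (ℤ × ℤ × ℤ → EuclideanSpace ℝ (Fin 3)) → ℝ, IsLocalFunctional φfar ∧
        ∃ n : ℕ, ∃ ds : Fin n → CorrDatum, (∀ i, (ds i).BallAdmissible 8) ∧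
          (∀ P : Measure (Measure (EuclideanSpace ℝ (Fin 3))), IsProbabilityMeasure P → PointStationary P → HcpLayered P →
            Integrable hNear P ∧ Integrable (chartAvg φfar) P ∧
              ∫ μ, hNear μ ∂P + ∫ μ, chartAvg φfar μ ∂P ≤ meanRootEnergy P) ∧
          (∀ S : Set (EuclideanSpace ℝ (Fin 3)), (0 : EuclideanSpace ℝ (Fin 3)) ∈ S → (∀ x ∈ S, GoodShell S x) →
            HcpCharted S →
              0 ≤ hNear ((Measure.count : Measure (EuclideanSpace ℝ (Fin 3))).restrict S) +
                chartAvg φfar ((Measure.count : Measure (EuclideanSpace ℝ (Fin 3))).restrict S) - hcpE a₀ h₀ -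
                κ * starDefect a₀ h₀ ((Measure.count : Measure (EuclideanSpace ℝ (Fin 3))).restrict S) +
                ∑ i, corrector (ds i) ((Measure.count : Measure (EuclideanSpace ℝ (Fin 3))).restrict S)) := by
  sorry

/-- **Glue (lead c4): the bulk co-Lipschitz floor `9/16` from S2 + T4** — `(1 − 3/8)·(9/10) = 9/16`; at labels `F ∘ Pᵢ = X`.
[folklore] -/
theorem bulkFloor_of_stubs
    (h2 : ∀ (F : EuclideanSpace ℝ (Fin 3) → EuclideanSpace ℝ (Fin 3)) (r δ m : ℝ), 0 < r → 0 ≤ δ → δ < 1 → 0 < m →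
      (∀ y : EuclideanSpace ℝ (Fin 3), ∃ a : ℝ, m ≤ a ∧ ∃ A : EuclideanSpace ℝ (Fin 3) ≃ₗᵢ[ℝ] EuclideanSpace ℝ (Fin 3),
        ∀ p ∈ Metric.ball y r, ∀ q ∈ Metric.ball y r, ‖(F p - F q) - a • (A p - A q)‖ ≤ δ * a * ‖p - q‖) →
      Function.Bijective F ∧ ∀ p q : EuclideanSpace ℝ (Fin 3), (1 - δ) * m * ‖p - q‖ ≤ ‖F p - F q‖)
    (h4 : ∀ S : Set (EuclideanSpace ℝ (Fin 3)), (∀ x ∈ S, GoodShell S x) → HcpCharted S →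
      ∀ X : ℤ × ℤ × ℤ → EuclideanSpace ℝ (Fin 3), IsRootedChart S X →
        ∃ F : EuclideanSpace ℝ (Fin 3) → EuclideanSpace ℝ (Fin 3),
          (∀ u : ℤ × ℤ × ℤ, F (hcpSite 1 (Real.sqrt (2 / 3)) u) = X u) ∧
          ∀ y : EuclideanSpace ℝ (Fin 3), ∃ a : ℝ, 9 / 10 ≤ a ∧
            ∃ A : EuclideanSpace ℝ (Fin 3) ≃ₗᵢ[ℝ] EuclideanSpace ℝ (Fin 3),
              ∀ p ∈ Metric.ball y (1 / 25 : ℝ), ∀ q ∈ Metric.ball y (1 / 25 : ℝ),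
                ‖(F p - F q) - a • (A p - A q)‖ ≤ 3 / 8 * a * ‖p - q‖) :
    ∀ S : Set (EuclideanSpace ℝ (Fin 3)), (∀ x ∈ S, GoodShell S x) → HcpCharted S →
      ∀ X : ℤ × ℤ × ℤ → EuclideanSpace ℝ (Fin 3), IsRootedChart S X → ∀ u w : ℤ × ℤ × ℤ,
        9 / 16 * dist (hcpSite 1 (Real.sqrt (2 / 3)) u) (hcpSite 1 (Real.sqrt (2 / 3)) w) ≤ dist (X u) (X w) := by
  intro S hS hC X hX u w
  obtain ⟨F, hFX, hloc⟩ := h4 S hS hC X hX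
  obtain ⟨-, hco⟩ := h2 F (1 / 25) (3 / 8) (9 / 10) (by norm_num) (by norm_num) (by norm_num) (by norm_num) hloc
  have h := hco (hcpSite 1 (Real.sqrt (2 / 3)) u) (hcpSite 1 (Real.sqrt (2 / 3)) w)
  rw [hFX, hFX] at h
  rw [dist_eq_norm, dist_eq_norm]
  have : (1 - 3 / 8 : ℝ) * (9 / 10) = 9 / 16 := by norm_num
  rw [this] at h
  exact h

/-- **`stub_finiteCertificate` (c3's registered statement), sorry-free from the lead-c4 stubs**: the bulk floor from S2 + T4
(`bulkFloor_of_stubs`) fed to R2′ `stub_certificateOfBulk`. [folklore] -/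
theorem stub_finiteCertificate :
    ∀ a₀ h₀ : ℝ, 189 / 200 ≤ a₀ → a₀ ≤ 199 / 200 → 77 / 100 ≤ h₀ → h₀ ≤ 163 / 200 →
      (∀ a h : ℝ, 0 < a → 0 < h → hcpE a₀ h₀ ≤ hcpE a h) →
      (∀ l m : Fin 3, hcpSiteStress a₀ h₀ l m = 0) →
      ∃ κ : ℝ, 0 < κ ∧ ∃ φfar : (ℤ × ℤ × ℤ → EuclideanSpace ℝ (Fin 3)) → ℝ, IsLocalFunctional φfar ∧
        ∃ n : ℕ, ∃ ds : Fin n → CorrDatum, (∀ i, (ds i).BallAdmissible 8) ∧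
          (∀ P : Measure (Measure (EuclideanSpace ℝ (Fin 3))), IsProbabilityMeasure P → PointStationary P → HcpLayered P →
            Integrable hNear P ∧ Integrable (chartAvg φfar) P ∧
              ∫ μ, hNear μ ∂P + ∫ μ, chartAvg φfar μ ∂P ≤ meanRootEnergy P) ∧
          (∀ S : Set (EuclideanSpace ℝ (Fin 3)), (0 : EuclideanSpace ℝ (Fin 3)) ∈ S → (∀ x ∈ S, GoodShell S x) →
            HcpCharted S →
              0 ≤ hNear ((Measure.count : Measure (EuclideanSpace ℝ (Fin 3))).restrict S) +
                chartAvg φfar ((Measure.count : Measure (EuclideanSpace ℝ (Fin 3))).restrict S) - hcpE a₀ h₀ -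
                κ * starDefect a₀ h₀ ((Measure.count : Measure (EuclideanSpace ℝ (Fin 3))).restrict S) +
                ∑ i, corrector (ds i) ((Measure.count : Measure (EuclideanSpace ℝ (Fin 3))).restrict S)) :=
  stub_certificateOfBulk (bulkFloor_of_stubs stub_globalInverse stub_chartInterpolation)

/-! ## The glue of the reshape: `stub_hcpTubeRigidity` from R2 + R3 (sorry-free) -/

/-- **The registered rigidity core `stub_hcpTubeRigidity`, sorry-free from the two certificate stubs** (lead c2 reshape): with
`Z = hNear + chartAvg φfar − e₀ + Σ_i corrector (ds i)`, the pointwise part gives `κ·starDefect ≤ Z` a.s. (samples are rooted hcp-charted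
tube configurations), the law part and the zero means give `∫ Z ≤ E_P[h] − e₀ ≤ 0`, and `0 ≤ κ·starDefect ≤ Z` a.e. with `∫ Z ≤ 0`
forces `Z = 0`, hence `starDefect = 0`, almost surely — no measurability of `starDefect` is needed. [folklore] -/
theorem hcpTubeRigidity_of_certificate :
    ∀ a₀ h₀ : ℝ, 189 / 200 ≤ a₀ → a₀ ≤ 199 / 200 → 77 / 100 ≤ h₀ → h₀ ≤ 163 / 200 →
      (∀ a h : ℝ, 0 < a → 0 < h → hcpE a₀ h₀ ≤ hcpE a h) →
      (∀ l m : Fin 3, hcpSiteStress a₀ h₀ l m = 0) →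
      ∀ P : Measure (Measure (EuclideanSpace ℝ (Fin 3))), IsProbabilityMeasure P → PointStationary P → HcpLayered P →
        meanRootEnergy P ≤ hcpE a₀ h₀ → ∀ᵐ μ ∂P, starDefect a₀ h₀ μ = 0 := by
  intro a₀ h₀ ha₁ ha₂ hh₁ hh₂ hmin hS0 P hP hStat hHcp hEn
  obtain ⟨κ, hκ, φfar, hφfar, n, ds, hds, hlaw, hpt⟩ := stub_finiteCertificate a₀ h₀ ha₁ ha₂ hh₁ hh₂ hmin hS0
  obtain ⟨hintN, hintF, hle⟩ := hlaw P hP hStat hHcp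
  have hcorr : ∀ i, Integrable (corrector (ds i)) P ∧ ∫ μ, corrector (ds i) μ ∂P = 0 :=
    fun i => Summit.AtomisticToContinuum.Crystallization.Theorems.PalmUnimodularRigidity.LayeredLawsSelectHcp.tube_correctorMeanZero_ball
      8 (by norm_num) (ds i) (hds i) P hP hStat hHcp
  -- the certificate functional
  set Z : Measure (EuclideanSpace ℝ (Fin 3)) → ℝ := fun μ =>
    hNear μ + chartAvg φfar μ - hcpE a₀ h₀ + ∑ i, corrector (ds i) μ with hZ
  have hintC : Integrable (fun μ => ∑ i, corrector (ds i) μ) P :=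
    integrable_finsetSum _ fun i _ => (hcorr i).1
  have hf : Integrable (fun μ => hNear μ + chartAvg φfar μ - hcpE a₀ h₀) P :=
    (hintN.add hintF).sub (integrable_const _)
  have hintZ : Integrable Z P := hf.add hintC
  -- (1) its mean is ≤ 0
  have hmean : ∫ μ, Z μ ∂P ≤ 0 := by
    have e1 : ∫ μ, Z μ ∂P = ∫ μ, (hNear μ + chartAvg φfar μ - hcpE a₀ h₀) ∂P + ∫ μ, (∑ i, corrector (ds i) μ) ∂P := by
      simp only [hZ]
      exact integral_add hf hintC
    have e2 : ∫ μ, (hNear μ + chartAvg φfar μ - hcpE a₀ h₀) ∂P =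
        ∫ μ, hNear μ ∂P + ∫ μ, chartAvg φfar μ ∂P - hcpE a₀ h₀ := by
      have hNF : Integrable (fun μ => hNear μ + chartAvg φfar μ) P := hintN.add hintF
      rw [integral_sub hNF (integrable_const _), integral_add hintN hintF, integral_const, smul_eq_mul]
      simp
    have e3 : ∫ μ, (∑ i, corrector (ds i) μ) ∂P = 0 := by
      rw [integral_finsetSum _ (fun i _ => (hcorr i).1)]
      exact Finset.sum_eq_zero fun i _ => (hcorr i).2
    rw [e1, e2, e3, add_zero]
    linarith
  -- (2) pointwise a.e.: κ · starDefect ≤ Z, through the a.s. structure of hcp-layered laws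
  have hHcp' : ∀ᵐ μ ∂P, ∃ S : Set (EuclideanSpace ℝ (Fin 3)),
      μ = (Measure.count : Measure (EuclideanSpace ℝ (Fin 3))).restrict S ∧ (∀ x ∈ S, GoodShell S x) ∧ HcpCharted S := hHcp
  have hLay : Layered P := by
    show ∀ᵐ μ ∂P, ∃ S : Set (EuclideanSpace ℝ (Fin 3)), μ = (Measure.count : Measure (EuclideanSpace ℝ (Fin 3))).restrict S ∧
      (∀ x ∈ S, GoodShell S x) ∧ BarlowLike S
    filter_upwards [hHcp'] with μ hμ
    obtain ⟨S, h1, h2, h3⟩ := hμ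
    exact ⟨S, h1, h2, alternatingHagg, isHaggSeq_alternating, h3⟩
  have hRoot' := rooted_of_pointStationary_layered hStat hLay
  have hptae : ∀ᵐ μ ∂P, κ * starDefect a₀ h₀ μ ≤ Z μ := by
    filter_upwards [hHcp', hRoot'] with μ hH hR
    obtain ⟨S, hμ, hgood, hch⟩ := hH
    obtain ⟨S', h0', -, hμ'⟩ := hR
    have hSS' : S = S' := set_eq_of_count_restrict_eq (hμ.symm.trans hμ')
    have h0 : (0 : EuclideanSpace ℝ (Fin 3)) ∈ S := by rw [hSS']; exact h0'
    have h := hpt S h0 hgood hch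
    rw [hZ]; rw [hμ]
    linarith
  -- (3) sandwich: 0 ≤ κ·D ≤ Z a.e. and ∫ Z ≤ 0 ⇒ Z = 0 a.e. ⇒ D = 0 a.e.
  have hZnn : 0 ≤ᵐ[P] Z := by
    filter_upwards [hptae] with μ hμ
    exact le_trans (mul_nonneg hκ.le (starDefect_nonneg a₀ h₀ μ)) hμ
  have hZint0 : ∫ μ, Z μ ∂P = 0 := le_antisymm hmean (integral_nonneg_of_ae hZnn)
  have hZ0 : Z =ᵐ[P] 0 := (integral_eq_zero_iff_of_nonneg_ae hZnn hintZ).1 hZint0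
  filter_upwards [hZ0, hptae] with μ hμ0 hμle
  have hle0 : κ * starDefect a₀ h₀ μ ≤ 0 := by rw [hμ0] at hμle; exact hμle
  have hnn := starDefect_nonneg a₀ h₀ μ
  nlinarith


/-- **STUB 4-core — LAW-LEVEL STRICT LOCAL MINIMALITY OF RELAXED HCP IN THE 1 % TUBE (the `e*`-free
analytic core of the rigidity half; lead's reshape, cycle 2).**  For the relaxed reference `(a₀, h₀)` (window,
global hcp-minimality and zero site stress as named inputs — all three LANDED: `stub_relaxedReference` p113318,
`stub_zeroStress` p91498, uniqueness `tube_hcpE_unique_minimiser` p116871) and EVERY point-stationary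
probability law a.s. carried by everywhere-`(1/100)`-good hcp-charted configurations whose mean root energy is
AT OR BELOW the relaxed-hcp level, `E_P[h] ≤ hcpE a₀ h₀`, almost surely the root star is an exact
linear-isometric copy of the relaxed reference star (`starDefect a₀ h₀ = 0`).  Equivalently (given the landed
Palm transfer, discrete Liouville and `rootEnergy_isometric_hcp`): the FLOOR `hcpE a₀ h₀ ≤ E_P[h]` over the
whole hcp-charted tube WITH ITS EQUALITY CASE — relaxed hcp is the unique minimiser of the mean root energy
among point-stationary hcp-layered laws (no boundary, no pressure: infinite-volume local minimality of the LJ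
hcp crystal against every stationary perturbation keeping the hcp bond graph and the 1 % shells, affine strains
and the scale drift `a ∈ [0.89, 1.01]` included).  This is the registered `stub_tubeZeroDefect` with the
uncomputable threshold `e*` replaced by the explicit hcp level (`e* ≤ hcpE a₀ h₀`).  `E_P[h]` is an honest
expectation on this class (`tube_rootEnergy_integrable`, p115944).  Mechanism = the card (`Ideas/mtp-prestress-split-ergodic-
frame.md`; triage r1-1/2/3): prestress split with explicit work term (`prestressSplitWithWork`, proved above) —
MTP additivity of the mean labelled bond vectors along the chart (`tube_pointShift_invariance`, p115079) makes the
expected work term `S:(R₀ᵀG − I) + ⟨R₀Σ_{A→B}ω_q q, t⟩`, killed by ZERO STRESS for every frame `R₀` — invariant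
Friesecke–James–Müller frame `R₀ = polar(E[Σ b_q qᵀ | 𝓘])` + measure-level Korn (`1 + K = 8.00`, no floppy
Bloch mode of the hcp strut framework, kits j012659/j012726/j012751) — Bloch-pointwise harmonic certificate with
cable Laplacians kept and the cable concavity tax carried to `6a` (closing ratio `ρ ∈ [0.40, 0.89] < 1`,
`κ_exact = λ_min(H,S) = 1.824`, kit j013064) — secant single-welledness of the tilted strut wells on the tube
(`c₁ ≥ 0.59`) for the nonlinear remainder — and `E[starDefect] ≤ C·E[Σ_bars stretch²]` (infinitesimal rigidity of the
centred 13-node anticuboctahedral framework + one Mecke averaging), so that `E_P[h] ≥ hcpE a₀ h₀ + κE[starDefect]`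
and the sublevel hypothesis forces `starDefect = 0` a.s.  Consistency: equality for the Palm law of `hcp(a₀,h₀)` (views `±hcp`,
`A = ±id`); strict for `hcp(a,h) ≠ hcp(a₀,h₀)` in the tube (= landed uniqueness); the fcc law is not in the
class.  Why it might fail: a soft supercell modulation of relaxed LJ hcp inside the 1 % tube with mean root
energy `< hcpE(a₀,h₀) = −0.7175896` (none known: LJ hcp is dynamically stable, `λ_min = 1.824`; disprover-wanted
since cycle 1), or — the real risk — SIZE: certified Bloch positivity over the Brillouin zone × tube, interval
lattice sums for the far field, the marked-chart Mecke calculus in Lean.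
MECHANISM CAVEAT (lead c1, cycle 2 — recorded in the memo): step (iii) of the card as an inequality over ALL
point-stationary hcp-layered laws is FALSE — there are point-stationary, even ergodic, hcp-layered laws whose
samples' local orientation WANDERS over `SO(3)` (blocks of size `ℓ` bent by `ε` each, strain `≤ ε`, excess
`O(ε²) → 0`), for which `E[b_q | 𝓘] ≈ 0`, no invariant frame `R₀` exists and `Σ_struts E‖b_q − R₀q‖²` is `O(1)`
against longitudinal defects `O(ε²)`.  The statement below is untouched (such laws pay `κ'ε² > 0`), but a proof
must be FRAME-FREE: expand in the squared bond lengths `s_q = ‖b_q‖²` only — zero stress kills the affine part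
IDENTICALLY (`Σ_q ω_q qᵀMq = S:M = 0` for every matrix `M`, in particular `M = FᵀF`, no rotation to choose),
zero INNER (sublattice) force kills the inner-displacement part (both LANDED: `affinePrestress_vanishes` p117838,
`sublatticeForce_vanishes` p118369), stationarity of bounded frame-free scalars plus exact Burgers-circuit closure
(`b_{e₁} + b_{e₂}∘θ_{e₁} = b_{e₂} + b_{e₁}∘θ_{e₂}`) and polarization kill the first-order NON-affine part
(`E‖b_{e₁+e₂}‖² = E‖b_{e₁}‖² + E‖b_{e₂}‖² + 2E⟨b_{e₁},b_{e₂}⟩ − E‖b_{e₁}∘θ_{e₂} − b_{e₁}‖²`: the curvature enters at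
SECOND order with a definite sign), and the quadratic form that remains is the FULL Bloch dynamical form of relaxed
hcp including the geometric (tension) stiffness
`Σ_q ω_q T_q` — whose certified positivity is the sibling item `PhononStability` (stmt-AtomisticToContinuum-9333,
route ExcessDecayLiouville) on the part of the tube inside its window, plus the gross elastic excess outside.
Size XL (crux-sized: promoted by the lead, see the lead's memo `Cruxes/LayeredLawsSelectHcp/NOTES.md` = item
evidence `promote-memo.md`). -/
theorem stub_hcpTubeRigidity :
    ∀ a₀ h₀ : ℝ, 189 / 200 ≤ a₀ → a₀ ≤ 199 / 200 → 77 / 100 ≤ h₀ → h₀ ≤ 163 / 200 →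
      (∀ a h : ℝ, 0 < a → 0 < h → hcpE a₀ h₀ ≤ hcpE a h) →
      (∀ l m : Fin 3, hcpSiteStress a₀ h₀ l m = 0) →
      ∀ P : Measure (Measure E3), IsProbabilityMeasure P → PointStationary P → HcpLayered P →
        meanRootEnergy P ≤ hcpE a₀ h₀ → ∀ᵐ μ ∂P, starDefect a₀ h₀ μ = 0 :=
  -- RESHAPED (lead c2, cycle 3): sorry-free from `stub_correctorMeanZero` + `stub_finiteCertificate`
  hcpTubeRigidity_of_certificate

/-- **The registered stub `stub_tubeZeroDefect` (zero congruence defect of MINIMISING hcp-layered laws),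
sorry-free from `stub_hcpTubeRigidity`** (glue): `E_P[h] ≤ e* ≤ e(hcp a₀ h₀) = hcpE a₀ h₀` (H3, `eStar_le`,
`hcpE_eq_energyPerParticle`) puts a minimising law in the sublevel class. [folklore] -/
theorem stub_tubeZeroDefect :
    ∀ a₀ h₀ : ℝ, 189 / 200 ≤ a₀ → a₀ ≤ 199 / 200 → 77 / 100 ≤ h₀ → h₀ ≤ 163 / 200 →
      (∀ a h : ℝ, 0 < a → 0 < h → hcpE a₀ h₀ ≤ hcpE a h) →
      (∀ l m : Fin 3, hcpSiteStress a₀ h₀ l m = 0) →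
      ∀ P : Measure (Measure E3), IsProbabilityMeasure P → PointStationary P →
        meanRootEnergy P ≤ eStar → HcpLayered P → ∀ᵐ μ ∂P, starDefect a₀ h₀ μ = 0 := by
  intro a₀ h₀ ha₁ ha₂ hh₁ hh₂ hmin hS0 P hP hStat hEn hHcp
  have ha0 : 0 < a₀ := by linarith
  have hh0 : 0 < h₀ := by linarith
  have hstar : eStar ≤ hcpE a₀ h₀ := by
    rw [hcpE_eq_energyPerParticle ha0.ne' hh0.ne']
    exact eStar_le _
  exact stub_hcpTubeRigidity a₀ h₀ ha₁ ha₂ hh₁ hh₂ hmin hS0 P hP hStat hHcp (hEn.trans hstar)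

/-- **STUB 5 — Palm transfer "root a.s. ⇒ every point a.s." (the unimodular lemma of support item 9228
`CruxesToPalmRigidity`; same statement, up to `Iff.rfl`, as `stub_everyPoint` of the sibling skeleton
`MinimiserShells/Lines/coarse-holonomy-liouville`).**  Under a point-stationary law a.s. carried by
counting measures of countable sets, an almost-sure property of the rooted configuration holds almost
surely at EVERY point after re-rooting: Mecke with `g(μ, y) = 1_N(θ_y μ)`, `N ⊇ Aᶜ` a measurable
`P`-null set, and `θ_{−y} θ_y μ = μ`; the right-hand side is `E[μ(ℝ³)·1_N(μ)] = 0`, so a.s. no point `y`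
of `μ` has `θ_y μ ∈ N`.  Lean cost: joint measurability of `(μ, y) ↦ μ.map (· − y)` for the Giry
σ-algebra (outer-measure form, arbitrary `A`).  Why it might fail: it is the mass-transport principle
itself; only the measurability plumbing is at risk. Size M.

RESHAPED by the lead (cycle 1): the carrier hypothesis is LOCAL FINITENESS (finite mass on every norm shell
`{⌊‖z‖⌋₊ = n}`), which is what the composition has (hard core `891/1000` of layered laws) and what the landed
Aldous–Lyons lemma `PalmUnimodularRigidity.ae_forall_map_sub_of_ae` consumes; PROVED by that lemma. [folklore;
AldousLyons2007 §2, Lemma 2.3] -/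
theorem stub_palmTransfer :
    ∀ P : Measure (Measure E3), PointStationary P →
      (∀ᵐ μ ∂P, ∀ n : ℕ, μ ((fun z : E3 => ⌊‖z‖⌋₊) ⁻¹' {n}) < ⊤) →
      ∀ A : Set (Measure E3), (∀ᵐ μ ∂P, μ ∈ A) →
        ∀ᵐ μ ∂P, ∀ y : E3, μ {y} ≠ 0 → Measure.map (fun z => z - y) μ ∈ A :=
  fun _ hStat hlf _ hA =>
    Summit.AtomisticToContinuum.Crystallization.Theorems.PalmUnimodularRigidity.ae_forall_map_sub_of_ae
      hStat hlf hA

/-- **STUB 6 — local congruence everywhere ⇒ global congruence (discrete Liouville endgame, pure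
geometry, no potential, no measure).**  If `0 ∈ S`, every point of `S` is `(1/100)`-good, `S` is
hcp-charted, and at EVERY point `x` the re-rooted star `{y − x : y ∈ S, 0 < |y − x| ≤ 11/10}` is an exact
linear-isometric copy of the relaxed reference star (`starDefect a₀ h₀ (count|(S − x)) = 0`: the infimum
over the compact `O(3)` is attained, the star has exactly twelve points, so `A_x(refStar) = star(x)`),
then `S = A(hcpStacking a₀ h₀)` for ONE linear isometry `A`: adjacent exact stars share the bond's two
ends and their four common neighbours (not coplanar), so `A_x = A_y` along every bond; the contact graph
is connected (chart); the exact anticuboctahedron has a unique hexagonal plane, so layers, spacing `h₀`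
and hcp registry propagate, giving `S = T(hcpStacking a₀ h₀)` for a rigid motion `T` with `T p = 0` at
the root's label `p`, and `hcpStacking − p = B(hcpStacking)` for a linear isometry `B`
(`hcpStacking_homogeneous`, in tree), whence `A = T_lin ∘ B`.  Why it might fail: it does not in the
window (`refStar` has twelve distinct points of norms `a₀ ≤ 0.995` and `√(a₀²/3 + h₀²) < 1`, inside the
star radius `11/10`); the risk is Lean bookkeeping only. Size M. -/
theorem stub_localCongruence :
    ∀ a₀ h₀ : ℝ, 189 / 200 ≤ a₀ → a₀ ≤ 199 / 200 → 77 / 100 ≤ h₀ → h₀ ≤ 163 / 200 →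
      ∀ S : Set E3, (0 : E3) ∈ S → (∀ x ∈ S, GoodShell S x) → HcpCharted S →
        (∀ x ∈ S, starDefect a₀ h₀
          ((Measure.count : Measure E3).restrict ((fun z : E3 => z - x) '' S)) = 0) →
        ∃ A : E3 ≃ₗᵢ[ℝ] E3, S = A '' hcpStacking a₀ h₀ :=
  -- LANDED (wave 1): Theorems/PalmUnimodularRigidityLayeredLawsSelectHcpLocalCongruence.lean (p102411)
  Summit.AtomisticToContinuum.Crystallization.Theorems.PalmUnimodularRigidity.LayeredLawsSelectHcp.stub_localCongruence

/-! ## The root energy of an isometric copy of relaxed hcp (the energy identity needs no floor) -/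

/-- **The root energy of `count|A(hcpStacking a h)` is `hcpE a h`** (for a hard-core carrier, `a, h ≠ 0`):
`½∫ V_LJ(‖y‖) d(count|S) = ½∑'_{S} V_LJ(‖·‖) = ½∑'_{hcp} V_LJ(‖A ·‖) = ½∑'_{hcp} V_LJ(‖·‖) = e(hcp a h) = hcpE a h`
(landed: `integral_count_restrict` of the MinimiserShells equilibrium-in-law line, `UniformlyDiscrete.summable_lennardJones`,
`energyPerParticle_hcp_eq_half_tsum` of the OneCentreSteepnessLadder line, `hcpE_eq_energyPerParticle`). [folklore] -/
theorem rootEnergy_isometric_hcp {a h : ℝ} (ha : a ≠ 0) (hh : h ≠ 0) {S : Set E3} (A : E3 ≃ₗᵢ[ℝ] E3)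
    (hS : S = A '' hcpStacking a h) {δ : ℝ} (hδ : 0 < δ)
    (hsep : ∀ x ∈ S, ∀ y ∈ S, x ≠ y → δ ≤ dist x y) :
    (∫ y, lennardJones ‖y‖ ∂(Measure.count : Measure E3).restrict S) / 2 = hcpE a h := by
  have hud : Literature.MathematicalPhysics.StatisticalMechanics.UniformlyDiscrete S := ⟨δ, hδ, hsep⟩
  have hcount : S.Countable := by
    rw [hS]
    exact (countable_hcpStacking a h).image _
  have hsum : Summable fun z : S => lennardJones ‖(z : E3)‖ := by
    have h0 := hud.summable_lennardJones 0
    refine h0.congr fun z => ?_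
    rw [dist_comm, dist_zero_right]
  have hmeas : Measurable fun z : E3 => lennardJones ‖z‖ :=
    Summit.AtomisticToContinuum.Crystallization.Theorems.PalmUnimodularRigidityMinimiserShells.EquilibriumInLaw.GainEvent.measurable_lennardJones.comp
      measurable_norm
  rw [Summit.AtomisticToContinuum.Crystallization.Theorems.PalmUnimodularRigidityMinimiserShells.EquilibriumInLaw.GainEvent.integral_count_restrict
    hcount hmeas hsum]
  -- re-index the sum over `S = A '' hcp` by `hcp` itself (`A` is injective and norm-preserving)
  have hre : ∑' z : S, lennardJones ‖(z : E3)‖ =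
      ∑' p : ↥(hcpStacking a h), lennardJones ‖(p : E3)‖ := by
    subst hS
    rw [← Equiv.tsum_eq (Equiv.Set.image (⇑A) (hcpStacking a h) A.injective)]
    refine tsum_congr fun p => ?_
    show lennardJones ‖A p‖ = lennardJones ‖(p : E3)‖
    rw [LinearIsometryEquiv.norm_map]
  rw [hre, hcpE_eq_energyPerParticle ha hh,
    Summit.AtomisticToContinuum.Crystallization.Theorems.DominationEnergyLimit.energyPerParticle_hcp_eq_half_tsum
      ha hh lennardJones lennardJones_zero]
  ring

/-! ## Composition: the stub STATEMENTS prove the crux BY NAME (sorry-free) -/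

/-- **The rigidity half, sorry-free from stubs 2–6** — and EXACTLY the statement `HcpWordRigidity`
(= registered `stub_hcpWordRigidity`) of the sibling skeleton `Lines/stress_jump_young_hagg_density.lean`,
whose `LayeredHcp P` is this file's `HcpLayered P` up to `δ`-unfolding (`hcpStacking 1 √(2/3)` IS
`barlowStacking 1 √(2/3) alternatingHagg`): every minimising point-stationary probability law that is
a.s. an hcp-charted tube configuration is a.s. an exact rotated relaxed hcp crystal with `e(hcp a₀ h₀) =
e*`.  H1 is not needed (`rooted_of_pointStationary_layered`, Negative.RootedRedundant).  Logic:
reference + zero stress ⇒ coercivity; the sandwich `E_P[h] ≤ e* ≤ e(hcp a₀ h₀) = hcpE a₀ h₀ ≤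
E_P[h] − κ E[starDefect]` (H3, `eStar_le`, `hcpE_eq_energyPerParticle`) gives `E[starDefect] = 0`,
`starDefect = 0` a.s. (`integral_eq_zero_iff_of_nonneg`) AND `e(hcp a₀ h₀) = e*`; Palm transfer ⇒ zero
defect at every point; discrete Liouville ⇒ `μ = count|A(hcpStacking a₀ h₀)`; the window gives
`(a₀, h₀) ∈ [1/2, 2]²`.  So the lead may discharge the sibling's `stub_hcpWordRigidity` with stubs 2–6
of this line, and this line's `stub_haggSelection` with the sibling's stubs 1–6. [folklore] -/
theorem hcpWordRigidity_of_stubs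
    (H2 : ∃ a₀ h₀ : ℝ, 189 / 200 ≤ a₀ ∧ a₀ ≤ 199 / 200 ∧ 77 / 100 ≤ h₀ ∧ h₀ ≤ 163 / 200 ∧
      ∀ a h : ℝ, 0 < a → 0 < h → hcpE a₀ h₀ ≤ hcpE a h)
    (H3 : ∀ a₀ h₀ : ℝ, 0 < a₀ → 0 < h₀ → (∀ a h : ℝ, 0 < a → 0 < h → hcpE a₀ h₀ ≤ hcpE a h) →
      ∀ l m : Fin 3, hcpSiteStress a₀ h₀ l m = 0)
    (H4 : ∀ a₀ h₀ : ℝ, 189 / 200 ≤ a₀ → a₀ ≤ 199 / 200 → 77 / 100 ≤ h₀ → h₀ ≤ 163 / 200 →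
      (∀ a h : ℝ, 0 < a → 0 < h → hcpE a₀ h₀ ≤ hcpE a h) →
      (∀ l m : Fin 3, hcpSiteStress a₀ h₀ l m = 0) →
      ∀ P : Measure (Measure E3), IsProbabilityMeasure P → PointStationary P →
        meanRootEnergy P ≤ eStar → HcpLayered P → ∀ᵐ μ ∂P, starDefect a₀ h₀ μ = 0)
    (H5 : ∀ P : Measure (Measure E3), PointStationary P →
      (∀ᵐ μ ∂P, ∀ n : ℕ, μ ((fun z : E3 => ⌊‖z‖⌋₊) ⁻¹' {n}) < ⊤) →
      ∀ A : Set (Measure E3), (∀ᵐ μ ∂P, μ ∈ A) →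
        ∀ᵐ μ ∂P, ∀ y : E3, μ {y} ≠ 0 → Measure.map (fun z => z - y) μ ∈ A)
    (H6 : ∀ a₀ h₀ : ℝ, 189 / 200 ≤ a₀ → a₀ ≤ 199 / 200 → 77 / 100 ≤ h₀ → h₀ ≤ 163 / 200 →
      ∀ S : Set E3, (0 : E3) ∈ S → (∀ x ∈ S, GoodShell S x) → HcpCharted S →
        (∀ x ∈ S, starDefect a₀ h₀
          ((Measure.count : Measure E3).restrict ((fun z : E3 => z - x) '' S)) = 0) →
        ∃ A : E3 ≃ₗᵢ[ℝ] E3, S = A '' hcpStacking a₀ h₀) :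
    ∀ P : Measure (Measure E3), IsProbabilityMeasure P → PointStationary P →
      meanRootEnergy P ≤ eStar → HcpLayered P → ∀ᵐ μ ∂P, IsRelaxedHcp μ := by
  intro P hP hStat hEn hHcp
  have hHcp' : ∀ᵐ μ ∂P, ∃ S : Set E3, μ = (Measure.count : Measure E3).restrict S ∧
      (∀ x ∈ S, GoodShell S x) ∧ HcpCharted S := hHcp
  -- H1 comes for free: hcp-charted ⇒ layered ⇒ rooted (Negative.RootedRedundant)
  have hLay : Layered P := by
    show ∀ᵐ μ ∂P, ∃ S : Set E3, μ = (Measure.count : Measure E3).restrict S ∧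
      (∀ x ∈ S, GoodShell S x) ∧ BarlowLike S
    filter_upwards [hHcp'] with μ hμ
    obtain ⟨S, h1, h2, h3⟩ := hμ
    exact ⟨S, h1, h2, hcpCharted_barlowLike h3⟩
  have hRoot' : ∀ᵐ μ ∂P, ∃ S : Set E3, (0 : E3) ∈ S ∧
      (∀ x ∈ S, ∀ y ∈ S, x ≠ y → (891 / 1000 : ℝ) ≤ dist x y) ∧
      μ = (Measure.count : Measure E3).restrict S :=
    rooted_of_pointStationary_layered hStat hLay
  -- REFERENCE (stub 2), ZERO STRESS (stub 3), COERCIVITY (stub 4)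
  obtain ⟨a₀, h₀, ha₁, ha₂, hh₁, hh₂, hmin⟩ := H2
  have ha0 : 0 < a₀ := by linarith
  have hh0 : 0 < h₀ := by linarith
  have hS0 : ∀ l m : Fin 3, hcpSiteStress a₀ h₀ l m = 0 := H3 a₀ h₀ ha0 hh0 hmin
  -- RIGIDITY (stub 4): zero congruence defect a.s. at the root
  have hWae := H4 a₀ h₀ ha₁ ha₂ hh₁ hh₂ hmin hS0 P hP hStat hEn hHcp
  -- … hence AT EVERY POINT (stub 5): hard-core configurations are locally finite
  have hlocfin : ∀ᵐ μ ∂P, ∀ n : ℕ, μ ((fun z : E3 => ⌊‖z‖⌋₊) ⁻¹' {n}) < ⊤ := by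
    filter_upwards [hRoot'] with μ hμ
    obtain ⟨S, -, hsep, hμS⟩ := hμ
    intro n
    rw [hμS]
    exact Summit.AtomisticToContinuum.Crystallization.Theorems.PalmUnimodularRigidity.count_restrict_floorNorm_preimage_lt_top
      (by norm_num : (0 : ℝ) < 891 / 1000) hsep n
  have hWevery : ∀ᵐ μ ∂P, ∀ y : E3, μ {y} ≠ 0 →
      Measure.map (fun z => z - y) μ ∈ {ν : Measure E3 | starDefect a₀ h₀ ν = 0} :=
    H5 P hStat hlocfin {ν : Measure E3 | starDefect a₀ h₀ ν = 0} hWae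
  -- DISCRETE LIOUVILLE (stub 6) sample by sample: the a.s. STRUCTURE, with the hard core kept
  have hstruct : ∀ᵐ μ ∂P, ∃ S : Set E3, μ = (Measure.count : Measure E3).restrict S ∧
      (∀ x ∈ S, ∀ y ∈ S, x ≠ y → (891 / 1000 : ℝ) ≤ dist x y) ∧
      ∃ A : E3 ≃ₗᵢ[ℝ] E3, S = A '' hcpStacking a₀ h₀ := by
    filter_upwards [hRoot', hHcp', hWevery] with μ hR hH hW
    obtain ⟨S', h0', hsep', hμ'⟩ := hR
    obtain ⟨S, hμ, hgood, hch⟩ := hH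
    have hSS' : S = S' := set_eq_of_count_restrict_eq (hμ.symm.trans hμ')
    have h0 : (0 : E3) ∈ S := by
      rw [hSS']
      exact h0'
    have hWx : ∀ x ∈ S, starDefect a₀ h₀
        ((Measure.count : Measure E3).restrict ((fun z : E3 => z - x) '' S)) = 0 := by
      intro x hx
      have hx' : μ {x} ≠ 0 := by
        rw [hμ]
        exact (count_restrict_singleton_ne_zero_iff S x).2 hx
      have h : starDefect a₀ h₀ (Measure.map (fun z : E3 => z - x) μ) = 0 := hW x hx'
      rw [hμ, map_sub_count_restrict] at h
      exact h
    obtain ⟨A, hA⟩ := H6 a₀ h₀ ha₁ ha₂ hh₁ hh₂ S h0 hgood hch hWx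
    refine ⟨S, hμ, ?_, A, hA⟩
    rw [hSS']
    exact hsep'
  -- THE ENERGY IDENTITY, AFTER the structure (no energy floor needed): every sample is an isometric
  -- copy of `hcp(a₀,h₀)`, whose root energy IS `hcpE a₀ h₀`; so `E_P[h] = hcpE a₀ h₀ ≤ e* ≤ e(hcp a₀ h₀)`.
  have hper : hcpE a₀ h₀ =
      (hcpPeriodicConfiguration ha0.ne' hh0.ne').energyPerParticle lennardJones :=
    hcpE_eq_energyPerParticle ha0.ne' hh0.ne'
  have hstar : eStar ≤ hcpE a₀ h₀ := by
    rw [hper]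
    exact eStar_le _
  have hroot_ae : ∀ᵐ μ ∂P, (∫ y, lennardJones ‖y‖ ∂μ) / 2 = hcpE a₀ h₀ := by
    filter_upwards [hstruct] with μ hμ
    obtain ⟨S, hμS, hsep, A, hA⟩ := hμ
    rw [hμS]
    exact rootEnergy_isometric_hcp ha0.ne' hh0.ne' A hA (by norm_num) hsep
  have hmean : meanRootEnergy P = hcpE a₀ h₀ := by
    show ∫ μ, (∫ y, lennardJones ‖y‖ ∂μ) / 2 ∂P = hcpE a₀ h₀
    rw [integral_congr_ae hroot_ae, integral_const, smul_eq_mul]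
    simp
  have hle : hcpE a₀ h₀ ≤ eStar := hmean.symm.le.trans hEn
  have henergy : (hcpPeriodicConfiguration ha0.ne' hh0.ne').energyPerParticle lennardJones =
      eStar := by
    rw [← hper]
    exact le_antisymm hle hstar
  -- CONCLUDE
  filter_upwards [hstruct] with μ hμ
  obtain ⟨S, hμS, -, A, hA⟩ := hμ
  refine ⟨a₀, h₀, ha0.ne', hh0.ne', by linarith, by linarith, by linarith, by linarith, A,
    henergy, ?_⟩
  rw [hμS, hA]

/-- **The logic of the whole line, sorry-free.**  The six stub statements (taken as hypotheses, so the
axiom closure of this theorem is clean) imply the crux's unfolded conclusion (`crux_iff` is `Iff.rfl`;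
`LayeredLawsSelectHcp_of` below is the by-name statement): SELECTION (stub 1) makes the law
hcp-charted, the rigidity half `hcpWordRigidity_of_stubs` (stubs 2–6) concludes; H1 and `δ` are not
used (Disproof `crux_iff_without_rooted`). [folklore] -/
theorem isRelaxedHcp_ae_of_stubs
    (H1 : ∀ P : Measure (Measure E3), IsProbabilityMeasure P → PointStationary P →
      meanRootEnergy P ≤ eStar → Layered P → HcpLayered P)
    (H2 : ∃ a₀ h₀ : ℝ, 189 / 200 ≤ a₀ ∧ a₀ ≤ 199 / 200 ∧ 77 / 100 ≤ h₀ ∧ h₀ ≤ 163 / 200 ∧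
      ∀ a h : ℝ, 0 < a → 0 < h → hcpE a₀ h₀ ≤ hcpE a h)
    (H3 : ∀ a₀ h₀ : ℝ, 0 < a₀ → 0 < h₀ → (∀ a h : ℝ, 0 < a → 0 < h → hcpE a₀ h₀ ≤ hcpE a h) →
      ∀ l m : Fin 3, hcpSiteStress a₀ h₀ l m = 0)
    (H4 : ∀ a₀ h₀ : ℝ, 189 / 200 ≤ a₀ → a₀ ≤ 199 / 200 → 77 / 100 ≤ h₀ → h₀ ≤ 163 / 200 →
      (∀ a h : ℝ, 0 < a → 0 < h → hcpE a₀ h₀ ≤ hcpE a h) →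
      (∀ l m : Fin 3, hcpSiteStress a₀ h₀ l m = 0) →
      ∀ P : Measure (Measure E3), IsProbabilityMeasure P → PointStationary P →
        meanRootEnergy P ≤ eStar → HcpLayered P → ∀ᵐ μ ∂P, starDefect a₀ h₀ μ = 0)
    (H5 : ∀ P : Measure (Measure E3), PointStationary P →
      (∀ᵐ μ ∂P, ∀ n : ℕ, μ ((fun z : E3 => ⌊‖z‖⌋₊) ⁻¹' {n}) < ⊤) →
      ∀ A : Set (Measure E3), (∀ᵐ μ ∂P, μ ∈ A) →
        ∀ᵐ μ ∂P, ∀ y : E3, μ {y} ≠ 0 → Measure.map (fun z => z - y) μ ∈ A)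
    (H6 : ∀ a₀ h₀ : ℝ, 189 / 200 ≤ a₀ → a₀ ≤ 199 / 200 → 77 / 100 ≤ h₀ → h₀ ≤ 163 / 200 →
      ∀ S : Set E3, (0 : E3) ∈ S → (∀ x ∈ S, GoodShell S x) → HcpCharted S →
        (∀ x ∈ S, starDefect a₀ h₀
          ((Measure.count : Measure E3).restrict ((fun z : E3 => z - x) '' S)) = 0) →
        ∃ A : E3 ≃ₗᵢ[ℝ] E3, S = A '' hcpStacking a₀ h₀) :
    ∀ δ : ℝ, 0 < δ → ∀ P : Measure (Measure E3), IsProbabilityMeasure P →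
      Rooted δ P → PointStationary P → meanRootEnergy P ≤ eStar → Layered P →
        ∀ᵐ μ ∂P, IsRelaxedHcp μ :=
  fun _ _ P hP _ hStat hEn hLay =>
    hcpWordRigidity_of_stubs H2 H3 H4 H5 H6 P hP hStat hEn (H1 P hP hStat hEn hLay)

/-- **`LayeredLawsSelectHcp_of`** — the skeleton theorem: the crux
`Summit.AtomisticToContinuum.Crystallization.Theses.PalmUnimodularRigidity.LayeredLawsSelectHcp` BY
NAME from the six planner stubs `stub_haggSelection`, `stub_relaxedReference`, `stub_zeroStress`,
`stub_tubeZeroDefect` (ex `stub_tubeCoercivity`), `stub_palmTransfer`, `stub_localCongruence` through the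
sorry-free `isRelaxedHcp_ae_of_stubs` and the definitional `Negative.DiracLaws.crux_iff`.  After the lead's
cycles 1–2 the ONLY declarations of this file containing `sorry` are the two analytic cores
`stub_haggSelection_cubicRootNull` (selection energetics) and `stub_tubeZeroDefect` (rigidity); the other four
planner stubs are proved from landed `Theorems/` files. -/
theorem LayeredLawsSelectHcp_of : LayeredLawsSelectHcp :=
  crux_iff.2
    (isRelaxedHcp_ae_of_stubs stub_haggSelection stub_relaxedReference stub_zeroStress
      stub_tubeZeroDefect stub_palmTransfer stub_localCongruence)

/-! ## Read-backs (definitional sanity; sorry-free) -/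

/-- The reference star has the root's twelve strut labels (Defs read-back). [folklore] -/
example : hcpStarIdx.card = 12 := card_hcpStarIdx

end Summit.AtomisticToContinuum.Crystallization.Cruxes.LayeredLawsSelectHcp.MtpPrestressSplitErgodicFrame

end
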